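import Literature.MathematicalPhysics.QuantumFieldTheory.Balaban1983to89.B3Ineq25Op116CollarRegion
import Literature.MathematicalPhysics.QuantumFieldTheory.Balaban1983to89.B3Op116CollarHolderBinder
import Literature.MathematicalPhysics.QuantumFieldTheory.Balaban1983to89.B3Op116CollarBoxFaces
import Literature.MathematicalPhysics.QuantumFieldTheory.Balaban1983to89.B3Op116CollarConfig

/-!
# Bałaban, *(Higgs)₂,₃ quantum fields in a finite volume III. Renormalization* [B3] — inequality (2.5) p. 424 for the ONE-`V_k`
COLLAR OPERATOR ON A `k`-BLOCK UNION AT HÖLDER EXPONENT `0 ≤ α < 1`, FROM THE (2.10)/(2.11) DICTIONARY — file «CollarRegionHolder»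
of the cell's Route δ (class (c) of p. 433): the (B)-level member with print's `α > 0`

statement-level skeleton of published theorems with citation tags; proofs where landed; nothing here is a claim about the Yang–Mills mass gap

T. Bałaban, Commun. Math. Phys. **88** (1983) 411–445 [cite: Balaban1983Higgs3]; part I, Commun. Math. Phys. **85** (1982) 603–636
[cite: Balaban1982Higgs1].  PDFs held: `paper:balaban1983-higgs-2-3-quantum-fields-finite-volume` (p. 414 = `p0004.txt`, p. 424 =
`p0014.txt`, p. 426 = `p0016.txt`, p. 433 = `p0023.txt`).

CITATION HEADER (lean-in-tree rule).  Cell `lit-balaban` (HOME `run/shared/lean/pub/lit-balaban/`), Phase-2 proof seat **p40** gen 77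
(unit `lit-balaban-p40`; filed by gen 78, literature-prover-lit-balaban-p40-g78-0); free-target protocol G.5-34(d), TAKING line HOME/STATUS.md 2026-08-23T12:41:06Z (cc r15 = fold owner of rows
B3.Txt@433 / B3.Prop1 / B3.Eq1.16 / B3.Eq2.5 / B3.Eq2.10 / B3.Eq2.11, p35, r14, p33); design note `lit-balaban-p40/DESIGN-B3-116-box.md`
§5/§5.1/§7 (Route δ; HOME/GAPS.md «G-B3-16 ADDENDUM 1», owner note l.2887).  LOCATED MEMBER — no head claim (decl of record
`B3Sect2StatementsPart2.ScaledKernels.Ineq25At`, r15).  USED BY NAME, never restated: p40 g77's `B3Op116CollarBinders` (six binders),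
`B3Ineq25Op116CollarRegion.top_le_binder`, `B3Op116CollarHolderBinder.{holder_far_of_deriv_row, holder_near_currency, mem_of_isAdm_near}`,
`B3Op116CollarKernel`, `B3Op116CollarRows.{top, farF, farC, faceC, collarC}`, `B3Op116CollarSources.{inB, exB, enB, mem_inB}`,
`B3Op116CollarDict.{apply_eq_zero_of_far_src, covDeriv_congr_of_apply_eq}`, `B3Ineq25Op116SmoothInner.ineq25At_op116_smooth_of_bounds_inner`,
`B3Op116CollarBoxFaces.{faces, exists_face_of_mem_exB, exists_face_of_mem_enB}`, `B3Op116CollarConfig.{farI_of_supp, farC_of_supp, nearP_of_supp}`,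
p35's `B3Op116MajorantStep.maj`, `B3Op116HolderKernelRegularTorus.holT`, `B3Op116LeibnizRows.pred`, the typer's `B1TorusChainTransport.{hol, hol_congr}`,
r14's `B3Ineq210RegularRegion.Interior`, `B3Ineq211RegularTorus.{IsAdm, one_le_tdist_of_ne'}`.

## What is printed

[B3] p. 414 [PDF 4]: *"the Hölder norms of the covariant derivatives of this kernel … are exponentially decaying with the distance of the
arguments and are uniformly bounded by O(1)(e(L^kε)^{1−α})^{n+n′}, where α > 0 but can be arbitrarily small."*; p. 424 (2.5) [PDF 14];
p. 426 (2.10)–(2.11) [PDF 16]; p. 433 [PDF 23] (class (c)).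

## What this file proves, and how

§1 `two_anchor_of_dict`: the two-anchor column bound of the Hölder functional `holT^Y_{x₁,x₂,Γ,μ} ∘ G_k(Ω,X)` from the (2.11) dictionary of
`G_k(Ω,X)` (transport and derivative in the background `X`) when `X` and `Y` agree on the bonds from the sites of `x₁ :: Γ` and at the two bonds.
§2 **`ineq25At_one_zero_collar_holder_of_dict`**: the (B)-level member at `0 ≤ α < 1` — as `B3Ineq25Op116CollarRegion.ineq25At_one_zero_collar_of_dict`
(six (2.10) dictionary families, `δG_k` clause at `α`, `Interior k K₀ Ω₂` points in `Ω` with their forward neighbours, far geometry) PLUS the (2.11)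
two-anchor dictionaries of `G_k(Ω,Y)` and `G_k(Ω,P+Y)` at all bonds `⊂ Ω`, sources in `Ω` and contours in `Ω`, a face family `Fc` covering the
endpoints in `Ω` of the bonds of `supp P` crossing `∂Ω`, the far geometry of every charged bond and of the ball `B(x, dL^k)` around interior points
(`ρ > d`, `K₀ ≥ 1`, `P` (I.2.23)-regular with `δ_P`): `(sect2Smooth116 … P Y … (L^kε) 1).Ineq25At 1 0 α (min δ_G (δ/4)) (C_G + (ε^d)^{-1}·farF(δ,ρ)·K_explicit)`, `farF = farC·e^{−δρ/4}` (the collar's exponential smallness in the leg length).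
Mechanism: the value/derivative/mixed binders of `B3Op116CollarBinders` in currency; the Hölder binders by the NEAR/FAR SPLIT — far pairs
(`L^kε ≤ ε|x₁−x₂|`) by `holder_far_of_deriv_row`, near pairs by `mem_of_isAdm_near` (the contour stays in `Ω₂ ⊆ Ω`), §1 and `holder_near_currency`.
§3 **`ineq25At_one_zero_collarBox_holder`**: the (C)-level discharge on `Ω = cellBox k K₀ S` — the (2.10) families by `colB_dcolB_le`/`mixedB_le`,
the (2.11) families by `hcolB_le` (`Y` and `P + Y`), the `δG_k` clause by `ineq25_smooth_regularNested` at `α`, common cube size (`≥ 1`) and rate;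
the face family and the geometry stay hypotheses (configuration data of class (c)).
§4 **`ineq25At_one_zero_collarBox_classC`**: §3 with the configuration data DISCHARGED — `Fc = faces k K₀ S` (`B3Op116CollarBoxFaces`) and
hfarI/hfarC/hnearP from ONE support condition `∀ b, P(b) ≠ 0 → ∀ Interior x, R ≤ |x − b₋|`, `ρL^k + L^k ≤ R`, `dL^k < R` (`B3Op116CollarConfig`).
`ineq25At_one_zero_collarBox_of_supp`: the `α = 0` member of `B3Ineq25Op116CollarRegion` with its far geometry from the same support condition.

## Honest scope

(B)-level (§2): dictionary entries, the `δG_k` clause, the face family and the geometry are HYPOTHESES; (C)-level (§3): the dictionary and the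
`δG_k` clause are DISCHARGED on a cell-product box, the face family (`hexF`/`henF`), the far geometry (`hfarI`/`hfarC`) and the vanishing of `P` on
the balls `B(x, dL^k)` around interior points (`hnearP`) remain hypotheses — they are properties of the Route δ collar part `P = B̃′(1−χ)`
(`supp P` at distance `≥ R = ρL^kε` from the localization region; the cell's proof-route deviation G-B3-16.A1, not a printed sentence), discharged
in §4.  Constants explicit but
`k`-dependent (declared divergence from print's `O(1)(e(L^kε)^{1−α})`); `(n,n′) ∈ {(1,0),(0,1)}` (both alternatives); orders `n + n′ = 2` not here.  HYPOTHESIS STRENGTH: `sup|P| ≤ s` and the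
regularity of `P` are taken TORUS-WIDE although the rows only read `P` on the bonds with an endpoint in `Ω` and their predecessors; print
controls `B̃′` on `□` only (p. 433: `|B̃ − B̃₀| ≤ O(r(L^kε)p(L^kε))` on `□`), so a caller localizes these two hypotheses or modifies `P` away from
`Ω` (successor bookkeeping; the operator is unchanged).
The class-(c) use on `□` is a RECORDED ROUTE DEVIATION from p. 433 l.12–15 (G-B3-16.A1).  Theorems only: no `def`, no `def … : Prop`, no new named
fact, no `sorry`; axioms standard.  Value = located member of a by-reference step of B3 — NOT summit progress and nothing about the Yang–Mills mass gap.
-/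

noncomputable section

open scoped BigOperators

namespace Literature.MathematicalPhysics.QuantumFieldTheory.Balaban1983to89.B3Ineq25Op116CollarRegionHolder

open HiggsLattice (ChargeData ScalarField covDeriv)
open HiggsCovariance (propagatorK E)
open HiggsCovariancePos (Inside)
open HiggsAveraging (blockK blockIter)
open B1Eq230FluctCov (Ix cb)
open B1TorusChainTransport (hol hol_congr)
open B3Ineq211RegularTorus (IsAdm one_le_tdist_of_ne')
open B3Ineq210RegularRegion (Interior)
open B3Ineq210MixedRegularTorus (onb dip)
open B3Eq116TwoSidedExpansion (op116)
open B3Op116SourceForm (srcV op116_succ_left_apply op116_succ_right_apply op116_zero_zero_apply)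
open B3Op116MajorantStep (maj maj_nonneg)
open B3Op116LeibnizRows (pred)
open B3Op116CollarRows (Far top farF farC faceC collarC farF_pos farC_pos faceC_nonneg collarC_nonneg top_const_mono)
open B3Op116CollarSources (inB exB enB mem_inB)
open B3Op116CollarDict (apply_eq_zero_of_far_src covDeriv_congr_of_apply_eq)
open B3Op116CollarBinders (value_binder_one_zero value_binder_zero_one deriv_binder_one_zero deriv_binder_zero_one
  mixed_binder_one_zero mixed_binder_zero_one col_state_all sum_dY_le_maj)
open B3Op116CollarHolderBinder (holder_far_of_deriv_row holder_near_currency mem_of_isAdm_near)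
open B3Ineq25Op116CollarRegion (top_le_binder)
open B3Op116HolderKernelRegularTorus (holT holT_apply)
open B3Ineq31SmoothLocalization (smoothConst)
open B3Ineq25SmoothLocalization (sect2DeltaSmooth)
open B3Ineq25Op116Smooth (sect2Smooth116)
open B3Ineq25Op116SmoothInner (ineq25At_op116_smooth_of_bounds_inner)

variable {P : HiggsLattice.Params} {N : ℕ}

/-! ## §1 The two-anchor column bound of the Hölder functional from the (2.11) dictionary -/

section TwoAnchor

variable (C : ChargeData N) (Ω : Finset (HiggsLattice.Site P 0)) (X Y : HiggsLattice.VecField P 0) (msq a : ℝ) {k : ℕ}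

/-- **The two-anchor column bound of `holT^Y ∘ G_k(Ω,X)` from the (2.11) dictionary of `G_k(Ω,X)`** when the backgrounds `X` (of the
dictionary's transport and derivative) and `Y` (of the functional) agree on the bonds from the sites of `x₁ :: Γ` and at `⟨x₁,μ⟩`, `⟨x₂,μ⟩`
(`x₁ ≠ x₂`): `Σ_i‖holT^Y(G_Xe_{(y,i)})‖ ≤ (ε|x₁−x₂|)^α·(𝔪(c_H,1−α)(x₁,y) + 𝔪(c_H,1−α)(x₂,y))` at every source `y ∈ Ω`.
[cite: Balaban1983Higgs3, (2.11) p.426] [cite: Balaban1983RegularityDecay, (1.4) p.572] -/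
theorem two_anchor_of_dict {x₁ x₂ : HiggsLattice.Site P 0} {μ : Fin P.d} {Γ : List (HiggsLattice.Site P 0)} (hne : x₁ ≠ x₂)
    {cH α δ : ℝ}
    (hdict : ∀ y ∈ Ω,
      (∑ i : Ix N, ‖hol C X x₁ Γ (covDeriv C X (propagatorK C Ω X msq a k (cb P N 0 (y, i))) ⟨x₂, μ⟩)
          - covDeriv C X (propagatorK C Ω X msq a k (cb P N 0 (y, i))) ⟨x₁, μ⟩‖)
          / (P.mesh 0 * (HiggsLattice.Site.tdist x₁ x₂ : ℝ)) ^ α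
        ≤ maj P k cH (1 - α) δ x₁ y + maj P k cH (1 - α) δ x₂ y)
    (hXY : ∀ z ∈ x₁ :: Γ, ∀ ν : Fin P.d, X ⟨z, ν⟩ = Y ⟨z, ν⟩) (h1 : X ⟨x₁, μ⟩ = Y ⟨x₁, μ⟩) (h2 : X ⟨x₂, μ⟩ = Y ⟨x₂, μ⟩) :
    ∀ y ∈ Ω, ∑ i : Ix N, ‖holT C Y x₁ x₂ Γ μ (propagatorK C Ω X msq a k (cb P N 0 (y, i)))‖
      ≤ (P.mesh 0 * (HiggsLattice.Site.tdist x₁ x₂ : ℝ)) ^ α * (maj P k cH (1 - α) δ x₁ y + maj P k cH (1 - α) δ x₂ y) := by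
  intro y hy
  have hθ : 0 < (P.mesh 0 * (HiggsLattice.Site.tdist x₁ x₂ : ℝ)) ^ α := by
    have h1' : (1 : ℝ) ≤ (HiggsLattice.Site.tdist x₁ x₂ : ℝ) := by exact_mod_cast one_le_tdist_of_ne' hne.symm
    exact Real.rpow_pos_of_pos (mul_pos (P.mesh_pos 0) (by linarith)) α
  have h := (div_le_iff₀ hθ).1 (hdict y hy)
  rw [mul_comm] at h
  have hhol : hol C Y x₁ Γ = hol C X x₁ Γ := (hol_congr C (fun z hz ν => hXY z hz ν)).symm
  refine le_of_eq_of_le (Finset.sum_congr rfl fun i _ => ?_) h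
  rw [holT_apply, hhol, covDeriv_congr_of_apply_eq C h1.symm, covDeriv_congr_of_apply_eq C h2.symm]

end TwoAnchor

/-! ## §2 The member at `0 ≤ α < 1` -/

section MemberHolder

open scoped Classical

variable {K₀ r₀ m : ℕ} {hL1 : 1 < P.L} (C : ChargeData N) (Ω Ω₂ : Finset (HiggsLattice.Site P 0)) (Pf Y : HiggsLattice.VecField P 0)
  {msq : ℝ} (a : ℝ) {k : ℕ} {c₁ c₂ : ℝ}
  (hmsq : 0 < msq) (hak : 0 ≤ B1.aSeq a P.L k)
  (hΩ : ∀ x x' : HiggsLattice.Site P 0, blockIter k x = blockIter k x' → (x ∈ Ω ↔ x' ∈ Ω))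
include hmsq hak hΩ

set_option maxHeartbeats 1600000 in
/-- **INEQUALITY (2.5) AT `(n,n′) = (1,0)`, HÖLDER EXPONENT `0 ≤ α < 1`, FOR THE ONE-`V_k` COLLAR OPERATOR ON A `k`-BLOCK UNION, FROM THE
(2.10)/(2.11) DICTIONARY** (see the module docstring, §2; generous heartbeats: eight binders with explicit constants). [cite: Balaban1983Higgs3, (2.5) p.424, (1.16) p.414, (2.10) p.426, (2.11) p.426, (1.32) p.420, p.433] [cite: Balaban1982Higgs1, Prop. 2.1 (2.24) p.610, (3.16) p.615] -/
theorem ineq25At_one_zero_collar_holder_of_dict (hL2 : 2 ≤ P.L) (hk1 : 1 ≤ k) (hkK : k ≤ P.K) (hK₀ : 1 ≤ K₀) {δ ρ : ℝ} (hδ : 0 < δ)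
    (hδ1 : δ ≤ 1)
    (hρ : 1 ≤ ρ) {s cY cYd cYm cPY cPYd cPYm : ℝ} (hs : 0 ≤ s) (hcY : 0 ≤ cY) (hcYd : 0 ≤ cYd) (hcYm : 0 ≤ cYm) (hcPY : 0 ≤ cPY)
    (hcPYd : 0 ≤ cPYd) (hcPYm : 0 ≤ cPYm) (hP : ∀ b : HiggsLattice.PBond P 0, |Pf b| ≤ s) (i₀ : Ix N)
    (hc₁ : 0 ≤ c₁) (hc₂ : 0 ≤ c₂) {δG CG : ℝ} (hCG : 0 ≤ CG) {α : ℝ} (hα0 : 0 ≤ α) (hα1 : α < 1)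
    {δA cYh cPYh : ℝ} (hδA : 0 ≤ δA) (hcYh : 0 ≤ cYh) (hcPYh : 0 ≤ cPYh)
    (hregP : ∀ (z : HiggsLattice.Site P 0) (μ ν : Fin P.d), |Pf ⟨z.shift ν, μ⟩ - Pf ⟨z, μ⟩| ≤ δA)
    (hδG : (sect2DeltaSmooth hL1 C Ω Ω₂ Y msq a k K₀ r₀ m c₁ c₂).Ineq25 α δG CG)
    (hhcolY : ∀ (μ : Fin P.d) (x₁ x₂ y : HiggsLattice.Site P 0), x₂ ≠ x₁ → x₁ ∈ Ω → x₁.shift μ ∈ Ω → x₂ ∈ Ω → x₂.shift μ ∈ Ω →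
      y ∈ Ω → ∀ Γ : List (HiggsLattice.Site P 0), IsAdm x₁ x₂ Γ → (∀ z ∈ Γ, z ∈ Ω) →
      (∑ i : Ix N, ‖hol C Y x₁ Γ (covDeriv C Y (propagatorK C Ω Y msq a k (cb P N 0 (y, i))) ⟨x₂, μ⟩)
          - covDeriv C Y (propagatorK C Ω Y msq a k (cb P N 0 (y, i))) ⟨x₁, μ⟩‖)
          / (P.mesh 0 * (HiggsLattice.Site.tdist x₁ x₂ : ℝ)) ^ α
        ≤ maj P k cYh (1 - α) δ x₁ y + maj P k cYh (1 - α) δ x₂ y)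
    (hhcolPY : ∀ (μ : Fin P.d) (x₁ x₂ y : HiggsLattice.Site P 0), x₂ ≠ x₁ → x₁ ∈ Ω → x₁.shift μ ∈ Ω → x₂ ∈ Ω → x₂.shift μ ∈ Ω →
      y ∈ Ω → ∀ Γ : List (HiggsLattice.Site P 0), IsAdm x₁ x₂ Γ → (∀ z ∈ Γ, z ∈ Ω) →
      (∑ i : Ix N, ‖hol C (Pf + Y) x₁ Γ (covDeriv C (Pf + Y) (propagatorK C Ω (Pf + Y) msq a k (cb P N 0 (y, i))) ⟨x₂, μ⟩)
          - covDeriv C (Pf + Y) (propagatorK C Ω (Pf + Y) msq a k (cb P N 0 (y, i))) ⟨x₁, μ⟩‖)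
          / (P.mesh 0 * (HiggsLattice.Site.tdist x₁ x₂ : ℝ)) ^ α
        ≤ maj P k cPYh (1 - α) δ x₁ y + maj P k cPYh (1 - α) δ x₂ y)
    (Fc : Finset (Σ ν : Fin P.d, ZMod (P.sitesPerDir 0 ν)))
    (hexF : ∀ b ∈ exB Ω Pf, ∃ f ∈ Fc, b.src f.1 = f.2) (henF : ∀ b ∈ enB Ω Pf, ∃ f ∈ Fc, b.tgt f.1 = f.2)
    (hcolY : ∀ u y : HiggsLattice.Site P 0, u ∈ Ω → y ∈ Ω →
      ∑ i : Ix N, ‖propagatorK C Ω Y msq a k (cb P N 0 (y, i)) u‖ ≤ maj P k cY 2 δ u y)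
    (hdcolY : ∀ y ∈ Ω, ∀ b : HiggsLattice.PBond P 0, Inside Ω b →
      ∑ i : Ix N, ‖covDeriv C Y (propagatorK C Ω Y msq a k (cb P N 0 (y, i))) b‖ ≤ maj P k cYd 1 δ b.src y)
    (hmixY : ∀ b b' : HiggsLattice.PBond P 0, Inside Ω b → Inside Ω b' →
      (P.mesh 0)⁻¹ * ∑ i : Ix N, ‖covDeriv C Y (propagatorK C Ω Y msq a k (dip C Y b' (onb N i))) b‖ ≤ maj P k cYm 0 δ b.src b'.src)
    (hcolPY : ∀ u y : HiggsLattice.Site P 0, u ∈ Ω → y ∈ Ω →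
      ∑ i : Ix N, ‖propagatorK C Ω (Pf + Y) msq a k (cb P N 0 (y, i)) u‖ ≤ maj P k cPY 2 δ u y)
    (hdcolPY : ∀ y ∈ Ω, ∀ b : HiggsLattice.PBond P 0, Inside Ω b →
      ∑ i : Ix N, ‖covDeriv C (Pf + Y) (propagatorK C Ω (Pf + Y) msq a k (cb P N 0 (y, i))) b‖ ≤ maj P k cPYd 1 δ b.src y)
    (hmixPY : ∀ b b' : HiggsLattice.PBond P 0, Inside Ω b → Inside Ω b' →
      (P.mesh 0)⁻¹ * ∑ i : Ix N, ‖covDeriv C (Pf + Y) (propagatorK C Ω (Pf + Y) msq a k (dip C (Pf + Y) b' (onb N i))) b‖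
        ≤ maj P k cPYm 0 δ b.src b'.src)
    (hsub : Ω₂ ⊆ Ω) (hI : ∀ x : HiggsLattice.Site P 0, Interior k K₀ Ω₂ x → x ∈ Ω ∧ ∀ μ : Fin P.d, x.shift μ ∈ Ω)
    (hfarI : ∀ x x' : HiggsLattice.Site P 0, Interior k K₀ Ω₂ x → Interior k K₀ Ω₂ x' →
      ∀ b : HiggsLattice.PBond P 0, Pf b ≠ 0 → ∀ z : HiggsLattice.Site P 0, blockIter k z = blockIter k b.src →
        Far P k ρ x z ∧ Far P k ρ z x')
    (hfarC : ∀ x x' : HiggsLattice.Site P 0, Interior k K₀ Ω₂ x → Interior k K₀ Ω₂ x' →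
      ∀ b : HiggsLattice.PBond P 0, (Pf b ≠ 0 ∨ Pf (pred b) ≠ 0) →
        (Far P k ρ x b.src ∧ Far P k ρ b.src x') ∧ (Far P k ρ x b.tgt ∧ Far P k ρ b.tgt x'))
    (hnearP : ∀ x : HiggsLattice.Site P 0, Interior k K₀ Ω₂ x →
      ∀ z : HiggsLattice.Site P 0, (HiggsLattice.Site.tdist x z : ℝ) ≤ (P.d : ℝ) * (P.L : ℝ) ^ k → ∀ ν : Fin P.d, Pf ⟨z, ν⟩ = 0) :
    (sect2Smooth116 hL1 C Ω Ω₂ Pf Y msq a k K₀ r₀ m c₁ c₂ (P.mesh k) 1).Ineq25At 1 0 α (min δG (δ / 4))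
      (CG + (P.mesh 0 ^ P.d)⁻¹ * farF P δ ρ *
        (smoothConst P.d m c₁ (c₂ + 2 * c₁) *
            ((collarC P N k δ 2 1 2 cY cYd cPY (cPYd + Real.exp 1 * cPY * P.mesh k * (|C.e| * s)) (|C.e| * s) 0 ((|C.e| * s) ^ 2) (|C.e| * s) 0
                  (|B1.aSeq a P.L k| * (P.mesh k)⁻¹ ^ 2 *
                  ((|C.e| * s * P.mesh 0 * (P.d * ((P.L : ℝ) ^ k - 1))) * (2 + |C.e| * s * P.mesh 0 * (P.d * ((P.L : ℝ) ^ k - 1)))))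
              + collarC P N k δ 2 1 2 cPY (cPYd + Real.exp 1 * cPY * P.mesh k * (|C.e| * s)) cY cYd (|C.e| * s) 0 ((|C.e| * s) ^ 2) (|C.e| * s) 0
                  (|B1.aSeq a P.L k| * (P.mesh k)⁻¹ ^ 2 *
                  ((|C.e| * s * P.mesh 0 * (P.d * ((P.L : ℝ) ^ k - 1))) * (2 + |C.e| * s * P.mesh 0 * (P.d * ((P.L : ℝ) ^ k - 1))))))
            + (collarC P N k δ 1 0 2 cYd cYm cPY (cPYd + Real.exp 1 * cPY * P.mesh k * (|C.e| * s)) (|C.e| * s) 0 ((|C.e| * s) ^ 2) (|C.e| * s) 0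
                  (|B1.aSeq a P.L k| * (P.mesh k)⁻¹ ^ 2 *
                  ((|C.e| * s * P.mesh 0 * (P.d * ((P.L : ℝ) ^ k - 1))) * (2 + |C.e| * s * P.mesh 0 * (P.d * ((P.L : ℝ) ^ k - 1)))))
              + collarC P N k δ 1 0 2 cPYd (cPYm + Real.exp 1 * cPYd * P.mesh k * ((|C.e| * s) * (Fintype.card (Ix N) : ℝ))) cY cYd (|C.e| * s) 0 ((|C.e| * s) ^ 2) (|C.e| * s) 0
                  (|B1.aSeq a P.L k| * (P.mesh k)⁻¹ ^ 2 *
                  ((|C.e| * s * P.mesh 0 * (P.d * ((P.L : ℝ) ^ k - 1))) * (2 + |C.e| * s * P.mesh 0 * (P.d * ((P.L : ℝ) ^ k - 1)))))))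
          + ((2 * (collarC P N k δ 1 0 2 cYd cYm cPY (cPYd + Real.exp 1 * cPY * P.mesh k * (|C.e| * s)) (|C.e| * s) 0 ((|C.e| * s) ^ 2) (|C.e| * s) 0
                  (|B1.aSeq a P.L k| * (P.mesh k)⁻¹ ^ 2 *
                  ((|C.e| * s * P.mesh 0 * (P.d * ((P.L : ℝ) ^ k - 1))) * (2 + |C.e| * s * P.mesh 0 * (P.d * ((P.L : ℝ) ^ k - 1)))))
              + collarC P N k δ 1 0 2 cPYd (cPYm + Real.exp 1 * cPYd * P.mesh k * ((|C.e| * s) * (Fintype.card (Ix N) : ℝ))) cY cYd (|C.e| * s) 0 ((|C.e| * s) ^ 2) (|C.e| * s) 0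
                  (|B1.aSeq a P.L k| * (P.mesh k)⁻¹ ^ 2 *
                  ((|C.e| * s * P.mesh 0 * (P.d * ((P.L : ℝ) ^ k - 1))) * (2 + |C.e| * s * P.mesh 0 * (P.d * ((P.L : ℝ) ^ k - 1))))))
            + ((2 * collarC P N k δ (1 - α) 0 2 cYh 0 cPY (cPYd + Real.exp 1 * cPY * P.mesh k * (|C.e| * s)) (|C.e| * s) ((P.mesh 0)⁻¹ * (|C.e| * δA)) ((|C.e| * s) ^ 2) 0 0
                  (|B1.aSeq a P.L k| * (P.mesh k)⁻¹ ^ 2 *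
                  ((|C.e| * s * P.mesh 0 * (P.d * ((P.L : ℝ) ^ k - 1))) * (2 + |C.e| * s * P.mesh 0 * (P.d * ((P.L : ℝ) ^ k - 1)))))
              + 2 * ((Fc.card : ℝ) * P.d * (((P.mesh 0)⁻¹ * (|C.e| * δA) + (P.mesh 0)⁻¹ * (|C.e| * s)) + (3 * ((P.mesh 0)⁻¹ * (|C.e| * s)) + 2 * (|C.e| * s) ^ 2)) * (cYh * (farC P δ * cPY) * faceC P (δ / 2))))
            + (2 * collarC P N k δ (1 - α) 0 2 cPYh 0 cY cYd (|C.e| * s) ((P.mesh 0)⁻¹ * (|C.e| * δA)) ((|C.e| * s) ^ 2) 0 0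
                  (|B1.aSeq a P.L k| * (P.mesh k)⁻¹ ^ 2 *
                  ((|C.e| * s * P.mesh 0 * (P.d * ((P.L : ℝ) ^ k - 1))) * (2 + |C.e| * s * P.mesh 0 * (P.d * ((P.L : ℝ) ^ k - 1)))))
              + 2 * ((Fc.card : ℝ) * P.d * (((P.mesh 0)⁻¹ * (|C.e| * δA) + (P.mesh 0)⁻¹ * (|C.e| * s)) + (3 * ((P.mesh 0)⁻¹ * (|C.e| * s)) + 2 * (|C.e| * s) ^ 2)) * (cPYh * (farC P δ * cY) * faceC P (δ / 2))))))
          + P.d * m * (collarC P N k δ 1 0 1 cYd cYm ((Fintype.card (Ix N) : ℝ) * cPYd) (cPYm + Real.exp 1 * cPYd * P.mesh k * ((|C.e| * s) * (Fintype.card (Ix N) : ℝ))) (|C.e| * s) 0 ((|C.e| * s) ^ 2) (|C.e| * s) 0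
                  (|B1.aSeq a P.L k| * (P.mesh k)⁻¹ ^ 2 *
                  ((|C.e| * s * P.mesh 0 * (P.d * ((P.L : ℝ) ^ k - 1))) * (2 + |C.e| * s * P.mesh 0 * (P.d * ((P.L : ℝ) ^ k - 1)))))
              + collarC P N k δ 1 0 1 cPYd (cPYm + Real.exp 1 * cPYd * P.mesh k * ((|C.e| * s) * (Fintype.card (Ix N) : ℝ))) ((Fintype.card (Ix N) : ℝ) * cYd) cYm (|C.e| * s) 0 ((|C.e| * s) ^ 2) (|C.e| * s) 0
                  (|B1.aSeq a P.L k| * (P.mesh k)⁻¹ ^ 2 *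
                  ((|C.e| * s * P.mesh 0 * (P.d * ((P.L : ℝ) ^ k - 1))) * (2 + |C.e| * s * P.mesh 0 * (P.d * ((P.L : ℝ) ^ k - 1))))))))) ∧
    (sect2Smooth116 hL1 C Ω Ω₂ Pf Y msq a k K₀ r₀ m c₁ c₂ (P.mesh k) 1).Ineq25At 0 1 α (min δG (δ / 4))
      (CG + (P.mesh 0 ^ P.d)⁻¹ * farF P δ ρ *
        (smoothConst P.d m c₁ (c₂ + 2 * c₁) *
            ((collarC P N k δ 2 1 2 cY cYd cPY (cPYd + Real.exp 1 * cPY * P.mesh k * (|C.e| * s)) (|C.e| * s) 0 ((|C.e| * s) ^ 2) (|C.e| * s) 0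
                  (|B1.aSeq a P.L k| * (P.mesh k)⁻¹ ^ 2 *
                  ((|C.e| * s * P.mesh 0 * (P.d * ((P.L : ℝ) ^ k - 1))) * (2 + |C.e| * s * P.mesh 0 * (P.d * ((P.L : ℝ) ^ k - 1)))))
              + collarC P N k δ 2 1 2 cPY (cPYd + Real.exp 1 * cPY * P.mesh k * (|C.e| * s)) cY cYd (|C.e| * s) 0 ((|C.e| * s) ^ 2) (|C.e| * s) 0
                  (|B1.aSeq a P.L k| * (P.mesh k)⁻¹ ^ 2 *
                  ((|C.e| * s * P.mesh 0 * (P.d * ((P.L : ℝ) ^ k - 1))) * (2 + |C.e| * s * P.mesh 0 * (P.d * ((P.L : ℝ) ^ k - 1))))))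
            + (collarC P N k δ 1 0 2 cYd cYm cPY (cPYd + Real.exp 1 * cPY * P.mesh k * (|C.e| * s)) (|C.e| * s) 0 ((|C.e| * s) ^ 2) (|C.e| * s) 0
                  (|B1.aSeq a P.L k| * (P.mesh k)⁻¹ ^ 2 *
                  ((|C.e| * s * P.mesh 0 * (P.d * ((P.L : ℝ) ^ k - 1))) * (2 + |C.e| * s * P.mesh 0 * (P.d * ((P.L : ℝ) ^ k - 1)))))
              + collarC P N k δ 1 0 2 cPYd (cPYm + Real.exp 1 * cPYd * P.mesh k * ((|C.e| * s) * (Fintype.card (Ix N) : ℝ))) cY cYd (|C.e| * s) 0 ((|C.e| * s) ^ 2) (|C.e| * s) 0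
                  (|B1.aSeq a P.L k| * (P.mesh k)⁻¹ ^ 2 *
                  ((|C.e| * s * P.mesh 0 * (P.d * ((P.L : ℝ) ^ k - 1))) * (2 + |C.e| * s * P.mesh 0 * (P.d * ((P.L : ℝ) ^ k - 1)))))))
          + ((2 * (collarC P N k δ 1 0 2 cYd cYm cPY (cPYd + Real.exp 1 * cPY * P.mesh k * (|C.e| * s)) (|C.e| * s) 0 ((|C.e| * s) ^ 2) (|C.e| * s) 0
                  (|B1.aSeq a P.L k| * (P.mesh k)⁻¹ ^ 2 *
                  ((|C.e| * s * P.mesh 0 * (P.d * ((P.L : ℝ) ^ k - 1))) * (2 + |C.e| * s * P.mesh 0 * (P.d * ((P.L : ℝ) ^ k - 1)))))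
              + collarC P N k δ 1 0 2 cPYd (cPYm + Real.exp 1 * cPYd * P.mesh k * ((|C.e| * s) * (Fintype.card (Ix N) : ℝ))) cY cYd (|C.e| * s) 0 ((|C.e| * s) ^ 2) (|C.e| * s) 0
                  (|B1.aSeq a P.L k| * (P.mesh k)⁻¹ ^ 2 *
                  ((|C.e| * s * P.mesh 0 * (P.d * ((P.L : ℝ) ^ k - 1))) * (2 + |C.e| * s * P.mesh 0 * (P.d * ((P.L : ℝ) ^ k - 1))))))
            + ((2 * collarC P N k δ (1 - α) 0 2 cYh 0 cPY (cPYd + Real.exp 1 * cPY * P.mesh k * (|C.e| * s)) (|C.e| * s) ((P.mesh 0)⁻¹ * (|C.e| * δA)) ((|C.e| * s) ^ 2) 0 0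
                  (|B1.aSeq a P.L k| * (P.mesh k)⁻¹ ^ 2 *
                  ((|C.e| * s * P.mesh 0 * (P.d * ((P.L : ℝ) ^ k - 1))) * (2 + |C.e| * s * P.mesh 0 * (P.d * ((P.L : ℝ) ^ k - 1)))))
              + 2 * ((Fc.card : ℝ) * P.d * (((P.mesh 0)⁻¹ * (|C.e| * δA) + (P.mesh 0)⁻¹ * (|C.e| * s)) + (3 * ((P.mesh 0)⁻¹ * (|C.e| * s)) + 2 * (|C.e| * s) ^ 2)) * (cYh * (farC P δ * cPY) * faceC P (δ / 2))))
            + (2 * collarC P N k δ (1 - α) 0 2 cPYh 0 cY cYd (|C.e| * s) ((P.mesh 0)⁻¹ * (|C.e| * δA)) ((|C.e| * s) ^ 2) 0 0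
                  (|B1.aSeq a P.L k| * (P.mesh k)⁻¹ ^ 2 *
                  ((|C.e| * s * P.mesh 0 * (P.d * ((P.L : ℝ) ^ k - 1))) * (2 + |C.e| * s * P.mesh 0 * (P.d * ((P.L : ℝ) ^ k - 1)))))
              + 2 * ((Fc.card : ℝ) * P.d * (((P.mesh 0)⁻¹ * (|C.e| * δA) + (P.mesh 0)⁻¹ * (|C.e| * s)) + (3 * ((P.mesh 0)⁻¹ * (|C.e| * s)) + 2 * (|C.e| * s) ^ 2)) * (cPYh * (farC P δ * cY) * faceC P (δ / 2))))))
          + P.d * m * (collarC P N k δ 1 0 1 cYd cYm ((Fintype.card (Ix N) : ℝ) * cPYd) (cPYm + Real.exp 1 * cPYd * P.mesh k * ((|C.e| * s) * (Fintype.card (Ix N) : ℝ))) (|C.e| * s) 0 ((|C.e| * s) ^ 2) (|C.e| * s) 0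
                  (|B1.aSeq a P.L k| * (P.mesh k)⁻¹ ^ 2 *
                  ((|C.e| * s * P.mesh 0 * (P.d * ((P.L : ℝ) ^ k - 1))) * (2 + |C.e| * s * P.mesh 0 * (P.d * ((P.L : ℝ) ^ k - 1)))))
              + collarC P N k δ 1 0 1 cPYd (cPYm + Real.exp 1 * cPYd * P.mesh k * ((|C.e| * s) * (Fintype.card (Ix N) : ℝ))) ((Fintype.card (Ix N) : ℝ) * cYd) cYm (|C.e| * s) 0 ((|C.e| * s) ^ 2) (|C.e| * s) 0
                  (|B1.aSeq a P.L k| * (P.mesh k)⁻¹ ^ 2 *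
                  ((|C.e| * s * P.mesh 0 * (P.d * ((P.L : ℝ) ^ k - 1))) * (2 + |C.e| * s * P.mesh 0 * (P.d * ((P.L : ℝ) ^ k - 1))))))))) := by
  -- names for the six row constants
  set κ₄ : ℝ := (|B1.aSeq a P.L k| * (P.mesh k)⁻¹ ^ 2 *
              ((|C.e| * s * P.mesh 0 * (P.d * ((P.L : ℝ) ^ k - 1))) * (2 + |C.e| * s * P.mesh 0 * (P.d * ((P.L : ℝ) ^ k - 1))))) with hκ₄
  set C10v : ℝ := collarC P N k δ 2 1 2 cY cYd cPY (cPYd + Real.exp 1 * cPY * P.mesh k * (|C.e| * s)) (|C.e| * s) 0 ((|C.e| * s) ^ 2) (|C.e| * s) 0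
            (|B1.aSeq a P.L k| * (P.mesh k)⁻¹ ^ 2 *
              ((|C.e| * s * P.mesh 0 * (P.d * ((P.L : ℝ) ^ k - 1))) * (2 + |C.e| * s * P.mesh 0 * (P.d * ((P.L : ℝ) ^ k - 1))))) with hC10v
  set C01v : ℝ := collarC P N k δ 2 1 2 cPY (cPYd + Real.exp 1 * cPY * P.mesh k * (|C.e| * s)) cY cYd (|C.e| * s) 0 ((|C.e| * s) ^ 2) (|C.e| * s) 0
            (|B1.aSeq a P.L k| * (P.mesh k)⁻¹ ^ 2 *
              ((|C.e| * s * P.mesh 0 * (P.d * ((P.L : ℝ) ^ k - 1))) * (2 + |C.e| * s * P.mesh 0 * (P.d * ((P.L : ℝ) ^ k - 1))))) with hC01v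
  set C10d : ℝ := collarC P N k δ 1 0 2 cYd cYm cPY (cPYd + Real.exp 1 * cPY * P.mesh k * (|C.e| * s)) (|C.e| * s) 0 ((|C.e| * s) ^ 2) (|C.e| * s) 0
            (|B1.aSeq a P.L k| * (P.mesh k)⁻¹ ^ 2 *
              ((|C.e| * s * P.mesh 0 * (P.d * ((P.L : ℝ) ^ k - 1))) * (2 + |C.e| * s * P.mesh 0 * (P.d * ((P.L : ℝ) ^ k - 1))))) with hC10d
  set C01d : ℝ := collarC P N k δ 1 0 2 cPYd (cPYm + Real.exp 1 * cPYd * P.mesh k * ((|C.e| * s) * (Fintype.card (Ix N) : ℝ))) cY cYd (|C.e| * s) 0 ((|C.e| * s) ^ 2) (|C.e| * s) 0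
            (|B1.aSeq a P.L k| * (P.mesh k)⁻¹ ^ 2 *
              ((|C.e| * s * P.mesh 0 * (P.d * ((P.L : ℝ) ^ k - 1))) * (2 + |C.e| * s * P.mesh 0 * (P.d * ((P.L : ℝ) ^ k - 1))))) with hC01d
  set C10m : ℝ := collarC P N k δ 1 0 1 cYd cYm ((Fintype.card (Ix N) : ℝ) * cPYd) (cPYm + Real.exp 1 * cPYd * P.mesh k * ((|C.e| * s) * (Fintype.card (Ix N) : ℝ))) (|C.e| * s) 0 ((|C.e| * s) ^ 2) (|C.e| * s) 0
            (|B1.aSeq a P.L k| * (P.mesh k)⁻¹ ^ 2 *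
              ((|C.e| * s * P.mesh 0 * (P.d * ((P.L : ℝ) ^ k - 1))) * (2 + |C.e| * s * P.mesh 0 * (P.d * ((P.L : ℝ) ^ k - 1))))) with hC10m
  set C01m : ℝ := collarC P N k δ 1 0 1 cPYd (cPYm + Real.exp 1 * cPYd * P.mesh k * ((|C.e| * s) * (Fintype.card (Ix N) : ℝ))) ((Fintype.card (Ix N) : ℝ) * cYd) cYm (|C.e| * s) 0 ((|C.e| * s) ^ 2) (|C.e| * s) 0
            (|B1.aSeq a P.L k| * (P.mesh k)⁻¹ ^ 2 *
              ((|C.e| * s * P.mesh 0 * (P.d * ((P.L : ℝ) ^ k - 1))) * (2 + |C.e| * s * P.mesh 0 * (P.d * ((P.L : ℝ) ^ k - 1))))) with hC01m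
  -- nonnegativity
  have hL1' : 1 < P.L := hL1
  have hF : 0 ≤ farF P δ ρ := (farF_pos hδ ρ).le
  have hES : 0 ≤ |C.e| * s := mul_nonneg (abs_nonneg _) hs
  have hNC : 0 ≤ (Fintype.card (Ix N) : ℝ) := Nat.cast_nonneg _
  have hmk : 0 ≤ P.mesh k := (P.mesh_pos k).le
  have he1 : 0 ≤ Real.exp 1 := (Real.exp_pos 1).le
  have hκ₄0 : 0 ≤ κ₄ := by
    have := B3Op116CollarSources.avgM_nonneg (P := P) C k hs
    rw [hκ₄]; positivity
  have hcPYd' : 0 ≤ cPYd + Real.exp 1 * cPY * P.mesh k * (|C.e| * s) := by positivity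
  have hcPYm' : 0 ≤ cPYm + Real.exp 1 * cPYd * P.mesh k * ((|C.e| * s) * (Fintype.card (Ix N) : ℝ)) := by positivity
  have hC10v0 : 0 ≤ C10v := collarC_nonneg hL1' k hδ (by norm_num) hcY hcYd hcPY hcPYd' hES le_rfl (pow_nonneg hES 2) hES le_rfl hκ₄0
  have hC01v0 : 0 ≤ C01v := collarC_nonneg hL1' k hδ (by norm_num) hcPY hcPYd' hcY hcYd hES le_rfl (pow_nonneg hES 2) hES le_rfl hκ₄0
  have hC10d0 : 0 ≤ C10d := collarC_nonneg hL1' k hδ (by norm_num) hcYd hcYm hcPY hcPYd' hES le_rfl (pow_nonneg hES 2) hES le_rfl hκ₄0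
  have hC01d0 : 0 ≤ C01d := collarC_nonneg hL1' k hδ (by norm_num) hcPYd hcPYm' hcY hcYd hES le_rfl (pow_nonneg hES 2) hES le_rfl hκ₄0
  have hC10m0 : 0 ≤ C10m :=
    collarC_nonneg hL1' k hδ (by norm_num) hcYd hcYm (mul_nonneg hNC hcPYd) hcPYm' hES le_rfl (pow_nonneg hES 2) hES le_rfl hκ₄0
  have hC01m0 : 0 ≤ C01m :=
    collarC_nonneg hL1' k hδ (by norm_num) hcPYd hcPYm' (mul_nonneg hNC hcYd) hcYm hES le_rfl (pow_nonneg hES 2) hES le_rfl hκ₄0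
  have hεd : 0 ≤ (P.mesh 0 ^ P.d)⁻¹ := inv_nonneg.mpr (pow_nonneg (P.mesh_pos 0).le _)
  have hCV : 0 ≤ (P.mesh 0 ^ P.d)⁻¹ * (farF P δ ρ * (C10v + C01v)) := by positivity
  have hCD : 0 ≤ (P.mesh 0 ^ P.d)⁻¹ * (farF P δ ρ * (C10d + C01d)) := by positivity
  have hCM : 0 ≤ (P.mesh 0 ^ P.d)⁻¹ * (farF P δ ρ * (C10m + C01m)) := by positivity
  have hCH : 0 ≤ 2 * ((P.mesh 0 ^ P.d)⁻¹ * (farF P δ ρ * (C10d + C01d))) := by positivity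
  have hδ4 : 0 ≤ δ / 4 := by positivity
  have ht : 0 ≤ P.mesh k * 1 := by rw [mul_one]; exact hmk
  have ht1 : (P.mesh k * 1) ^ (1 + 0) = P.mesh k := by norm_num
  -- the currency conversion, for a row constant `c ≤ Csum`
  have conv : ∀ {c Csum S : ℝ} (e : ℝ) (n : ℕ), e = (n : ℝ) + 1 → ∀ {x x' : HiggsLattice.Site P 0},
      S ≤ top P k (farF P δ ρ * c) e (δ / 4) x x' → c ≤ Csum →
      (P.mesh 0 ^ P.d)⁻¹ * S ≤ ((P.mesh 0 ^ P.d)⁻¹ * (farF P δ ρ * Csum)) * P.mesh k * (P.mesh k ^ n * (P.mesh k ^ P.d)⁻¹) *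
        Real.exp (-(δ / 4 * ((HiggsLattice.Site.tdist x x' : ℝ) / (P.L : ℝ) ^ k))) := by
    intro c Csum S e n he x x' hS hc
    subst he
    have h1 : (P.mesh 0 ^ P.d)⁻¹ * S ≤ (P.mesh 0 ^ P.d)⁻¹ * top P k (farF P δ ρ * Csum) ((n : ℝ) + 1) (δ / 4) x x' :=
      mul_le_mul_of_nonneg_left (hS.trans (top_const_mono (mul_le_mul_of_nonneg_left hc hF) x x')) hεd
    exact h1.trans (top_le_binder le_rfl n (δ / 4) x x')
  -- the row-derivative binders (used twice: `hDv` and, through F3's `α = 0` lemma, `hH`)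
  have hDv : ∀ (μ : Fin P.d) (x x' : HiggsLattice.Site P 0), Interior k K₀ Ω₂ x → Interior k K₀ Ω₂ x' →
      (P.mesh 0 ^ P.d)⁻¹ * ∑ i' : Ix N, ‖covDeriv C Y (op116 C Ω Pf Y msq a k 1 0 (cb P N 0 (x', i'))) ⟨x, μ⟩‖
        ≤ ((P.mesh 0 ^ P.d)⁻¹ * (farF P δ ρ * (C10d + C01d))) * (P.mesh k * 1) ^ (1 + 0) * (P.mesh k * (P.mesh k ^ P.d)⁻¹) *
          Real.exp (-(δ / 4 * ((HiggsLattice.Site.tdist x x' : ℝ) / (P.L : ℝ) ^ k))) := by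
    intro μ x x' hx hx'
    have hb₀ : Inside Ω (⟨x, μ⟩ : HiggsLattice.PBond P 0) := ⟨(hI x hx).1, (hI x hx).2 μ⟩
    have hb := deriv_binder_one_zero C Ω Pf Y a hmsq hak hΩ hL2 hkK hδ hδ1 hρ hs hcYd hcYm hcPY hcPYd hP i₀ hdcolY hmixY hcolPY hdcolPY
      hb₀ (hI x' hx').1 (hfarI x x' hx hx')
    have h := conv 2 1 (by norm_num) hb (le_add_of_nonneg_right hC01d0)
    rw [pow_one] at h
    rwa [ht1]
  have hDv' : ∀ (μ : Fin P.d) (x x' : HiggsLattice.Site P 0), Interior k K₀ Ω₂ x → Interior k K₀ Ω₂ x' →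
      (P.mesh 0 ^ P.d)⁻¹ * ∑ i' : Ix N, ‖covDeriv C Y (op116 C Ω Pf Y msq a k 0 1 (cb P N 0 (x', i'))) ⟨x, μ⟩‖
        ≤ ((P.mesh 0 ^ P.d)⁻¹ * (farF P δ ρ * (C10d + C01d))) * (P.mesh k * 1) ^ (1 + 0) * (P.mesh k * (P.mesh k ^ P.d)⁻¹) *
          Real.exp (-(δ / 4 * ((HiggsLattice.Site.tdist x x' : ℝ) / (P.L : ℝ) ^ k))) := by
    intro μ x x' hx hx'
    have hb₀ : Inside Ω (⟨x, μ⟩ : HiggsLattice.PBond P 0) := ⟨(hI x hx).1, (hI x hx).2 μ⟩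
    have hb := deriv_binder_zero_one C Ω Pf Y a hmsq hak hΩ hL2 hkK hδ hδ1 hρ hs hcY hcYd hcPYd hcPYm hP i₀ hcolY hdcolY hdcolPY hmixPY
      hb₀ (hI x' hx').1 (hfarI x x' hx hx')
    have h := conv 2 1 (by norm_num) hb (le_add_of_nonneg_left hC10d0)
    rw [pow_one] at h
    rwa [ht1]
  have hCDt : 0 ≤ ((P.mesh 0 ^ P.d)⁻¹ * (farF P δ ρ * (C10d + C01d))) * (P.mesh k * 1) ^ (1 + 0) := by positivity
  have hV : ∀ (x x' : HiggsLattice.Site P 0), Interior k K₀ Ω₂ x → Interior k K₀ Ω₂ x' →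
      (P.mesh 0 ^ P.d)⁻¹ * ∑ i' : Ix N, ‖op116 C Ω Pf Y msq a k 1 0 (cb P N 0 (x', i')) x‖
        ≤ ((P.mesh 0 ^ P.d)⁻¹ * (farF P δ ρ * (C10v + C01v))) * (P.mesh k * 1) ^ (1 + 0) * (P.mesh k ^ 2 * (P.mesh k ^ P.d)⁻¹) *
          Real.exp (-(δ / 4 * ((HiggsLattice.Site.tdist x x' : ℝ) / (P.L : ℝ) ^ k))) := by
    intro x x' hx hx'
    have hb := value_binder_one_zero C Ω Pf Y a hmsq hak hΩ hL2 hkK hδ hδ1 hρ hs hcY hcYd hcPY hcPYd hP i₀ hcolY hdcolY hcolPY hdcolPY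
      (hI x hx).1 (hI x' hx').1 (hfarI x x' hx hx')
    have h := conv 3 2 (by norm_num) hb (le_add_of_nonneg_right hC01v0)
    rwa [ht1]
  have hV' : ∀ (x x' : HiggsLattice.Site P 0), Interior k K₀ Ω₂ x → Interior k K₀ Ω₂ x' →
      (P.mesh 0 ^ P.d)⁻¹ * ∑ i' : Ix N, ‖op116 C Ω Pf Y msq a k 0 1 (cb P N 0 (x', i')) x‖
        ≤ ((P.mesh 0 ^ P.d)⁻¹ * (farF P δ ρ * (C10v + C01v))) * (P.mesh k * 1) ^ (1 + 0) * (P.mesh k ^ 2 * (P.mesh k ^ P.d)⁻¹) *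
          Real.exp (-(δ / 4 * ((HiggsLattice.Site.tdist x x' : ℝ) / (P.L : ℝ) ^ k))) := by
    intro x x' hx hx'
    have hb := value_binder_zero_one C Ω Pf Y a hmsq hak hΩ hL2 hkK hδ hδ1 hρ hs hcY hcYd hcPY hcPYd hP i₀ hcolY hdcolY hcolPY hdcolPY
      (hI x hx).1 (hI x' hx').1 (hfarI x x' hx hx')
    have h := conv 3 2 (by norm_num) hb (le_add_of_nonneg_left hC10v0)
    rwa [ht1]
  have hM : ∀ (μ ν : Fin P.d) (x x' : HiggsLattice.Site P 0), Interior k K₀ Ω₂ x → Interior k K₀ Ω₂ x' →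
      (P.mesh 0 ^ P.d)⁻¹ * ((P.mesh 0)⁻¹ *
          ∑ i : Ix N, ‖covDeriv C Y (op116 C Ω Pf Y msq a k 1 0 (dip C Y ⟨x', ν⟩ (onb N i))) ⟨x, μ⟩‖)
        ≤ ((P.mesh 0 ^ P.d)⁻¹ * (farF P δ ρ * (C10m + C01m))) * (P.mesh k * 1) ^ (1 + 0) * (P.mesh k ^ P.d)⁻¹ *
          Real.exp (-(δ / 4 * ((HiggsLattice.Site.tdist x x' : ℝ) / (P.L : ℝ) ^ k))) := by
    intro μ ν x x' hx hx'
    have hb₀ : Inside Ω (⟨x, μ⟩ : HiggsLattice.PBond P 0) := ⟨(hI x hx).1, (hI x hx).2 μ⟩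
    have hc : Inside Ω (⟨x', ν⟩ : HiggsLattice.PBond P 0) := ⟨(hI x' hx').1, (hI x' hx').2 ν⟩
    have hb := mixed_binder_one_zero C Ω Pf Y a hmsq hak hΩ hL2 hkK hδ hδ1 hρ hs hcYd hcYm hcPYd hcPYm hP i₀ hdcolY hmixY hdcolPY hmixPY
      hb₀ hc (hfarI x x' hx hx')
    have h := conv 1 0 (by norm_num) hb (le_add_of_nonneg_right hC01m0)
    rw [pow_zero, one_mul] at h
    rwa [ht1]
  have hM' : ∀ (μ ν : Fin P.d) (x x' : HiggsLattice.Site P 0), Interior k K₀ Ω₂ x → Interior k K₀ Ω₂ x' →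
      (P.mesh 0 ^ P.d)⁻¹ * ((P.mesh 0)⁻¹ *
          ∑ i : Ix N, ‖covDeriv C Y (op116 C Ω Pf Y msq a k 0 1 (dip C Y ⟨x', ν⟩ (onb N i))) ⟨x, μ⟩‖)
        ≤ ((P.mesh 0 ^ P.d)⁻¹ * (farF P δ ρ * (C10m + C01m))) * (P.mesh k * 1) ^ (1 + 0) * (P.mesh k ^ P.d)⁻¹ *
          Real.exp (-(δ / 4 * ((HiggsLattice.Site.tdist x x' : ℝ) / (P.L : ℝ) ^ k))) := by
    intro μ ν x x' hx hx'
    have hb₀ : Inside Ω (⟨x, μ⟩ : HiggsLattice.PBond P 0) := ⟨(hI x hx).1, (hI x hx).2 μ⟩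
    have hc : Inside Ω (⟨x', ν⟩ : HiggsLattice.PBond P 0) := ⟨(hI x' hx').1, (hI x' hx').2 ν⟩
    have hb := mixed_binder_zero_one C Ω Pf Y a hmsq hak hΩ hL2 hkK hδ hδ1 hρ hs hcYd hcYm hcPYd hcPYm hP i₀ hdcolY hmixY hdcolPY hmixPY
      hb₀ hc (hfarI x x' hx hx')
    have h := conv 1 0 (by norm_num) hb (le_add_of_nonneg_left hC10m0)
    rw [pow_zero, one_mul] at h
    rwa [ht1]
  -- the Hölder binders: NEAR/FAR SPLIT
  set CHn10 : ℝ := (2 * ((P.mesh 0 ^ P.d)⁻¹ * (farF P δ ρ * collarC P N k δ (1 - α) 0 2 cYh 0 cPY (cPYd + Real.exp 1 * cPY * P.mesh k * (|C.e| * s)) (|C.e| * s) ((P.mesh 0)⁻¹ * (|C.e| * δA)) ((|C.e| * s) ^ 2) 0 0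
                  (|B1.aSeq a P.L k| * (P.mesh k)⁻¹ ^ 2 *
                  ((|C.e| * s * P.mesh 0 * (P.d * ((P.L : ℝ) ^ k - 1))) * (2 + |C.e| * s * P.mesh 0 * (P.d * ((P.L : ℝ) ^ k - 1)))))))
              + 2 * ((Fc.card : ℝ) * P.d * (((P.mesh 0)⁻¹ * (|C.e| * δA) + (P.mesh 0)⁻¹ * (|C.e| * s)) + (3 * ((P.mesh 0)⁻¹ * (|C.e| * s)) + 2 * (|C.e| * s) ^ 2)) *
                ((P.mesh 0 ^ P.d)⁻¹ * (farF P δ ρ * cYh * (farC P δ * cPY) * faceC P (δ / 2))))) with hCHn10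
  set CHn01 : ℝ := (2 * ((P.mesh 0 ^ P.d)⁻¹ * (farF P δ ρ * collarC P N k δ (1 - α) 0 2 cPYh 0 cY cYd (|C.e| * s) ((P.mesh 0)⁻¹ * (|C.e| * δA)) ((|C.e| * s) ^ 2) 0 0
                  (|B1.aSeq a P.L k| * (P.mesh k)⁻¹ ^ 2 *
                  ((|C.e| * s * P.mesh 0 * (P.d * ((P.L : ℝ) ^ k - 1))) * (2 + |C.e| * s * P.mesh 0 * (P.d * ((P.L : ℝ) ^ k - 1)))))))
              + 2 * ((Fc.card : ℝ) * P.d * (((P.mesh 0)⁻¹ * (|C.e| * δA) + (P.mesh 0)⁻¹ * (|C.e| * s)) + (3 * ((P.mesh 0)⁻¹ * (|C.e| * s)) + 2 * (|C.e| * s) ^ 2)) *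
                ((P.mesh 0 ^ P.d)⁻¹ * (farF P δ ρ * cPYh * (farC P δ * cY) * faceC P (δ / 2))))) with hCHn01
  have hκ₂0 : 0 ≤ (P.mesh 0)⁻¹ * (|C.e| * δA) := by have := (P.mesh_pos 0).le; positivity
  have hfC : 0 ≤ farC P δ := (farC_pos (P := P) hδ).le
  have hfaceC : 0 ≤ faceC P (δ / 2) := faceC_nonneg (by positivity)
  have hd0 : (0 : ℝ) ≤ (P.d : ℝ) := Nat.cast_nonneg _
  have hC10h0 : 0 ≤ collarC P N k δ (1 - α) 0 2 cYh 0 cPY (cPYd + Real.exp 1 * cPY * P.mesh k * (|C.e| * s)) (|C.e| * s) ((P.mesh 0)⁻¹ * (|C.e| * δA)) ((|C.e| * s) ^ 2) 0 0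
                  (|B1.aSeq a P.L k| * (P.mesh k)⁻¹ ^ 2 *
                  ((|C.e| * s * P.mesh 0 * (P.d * ((P.L : ℝ) ^ k - 1))) * (2 + |C.e| * s * P.mesh 0 * (P.d * ((P.L : ℝ) ^ k - 1))))) :=
    collarC_nonneg (aK := 1 - α) (aKd := 0) hL1' k hδ (by norm_num) hcYh le_rfl hcPY hcPYd' hES hκ₂0 (pow_nonneg hES 2) le_rfl le_rfl hκ₄0
  have hC01h0 : 0 ≤ collarC P N k δ (1 - α) 0 2 cPYh 0 cY cYd (|C.e| * s) ((P.mesh 0)⁻¹ * (|C.e| * δA)) ((|C.e| * s) ^ 2) 0 0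
                  (|B1.aSeq a P.L k| * (P.mesh k)⁻¹ ^ 2 *
                  ((|C.e| * s * P.mesh 0 * (P.d * ((P.L : ℝ) ^ k - 1))) * (2 + |C.e| * s * P.mesh 0 * (P.d * ((P.L : ℝ) ^ k - 1))))) :=
    collarC_nonneg (aK := 1 - α) (aKd := 0) hL1' k hδ (by norm_num) hcPYh le_rfl hcY hcYd hES hκ₂0 (pow_nonneg hES 2) le_rfl le_rfl hκ₄0
  have hKEX : 0 ≤ (((P.mesh 0)⁻¹ * (|C.e| * δA) + (P.mesh 0)⁻¹ * (|C.e| * s)) + (3 * ((P.mesh 0)⁻¹ * (|C.e| * s)) + 2 * (|C.e| * s) ^ 2)) := by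
    have := (P.mesh_pos 0).le; positivity
  have hCf10 : 0 ≤ farF P δ ρ * cYh * (farC P δ * cPY) * faceC P (δ / 2) :=
    mul_nonneg (mul_nonneg (mul_nonneg hF hcYh) (mul_nonneg hfC hcPY)) hfaceC
  have hCf01 : 0 ≤ farF P δ ρ * cPYh * (farC P δ * cY) * faceC P (δ / 2) :=
    mul_nonneg (mul_nonneg (mul_nonneg hF hcPYh) (mul_nonneg hfC hcY)) hfaceC
  have h2 : (0 : ℝ) ≤ 2 := by norm_num
  have hcardK : 0 ≤ (Fc.card : ℝ) * P.d * (((P.mesh 0)⁻¹ * (|C.e| * δA) + (P.mesh 0)⁻¹ * (|C.e| * s)) + (3 * ((P.mesh 0)⁻¹ * (|C.e| * s)) + 2 * (|C.e| * s) ^ 2)) :=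
    mul_nonneg (mul_nonneg (Nat.cast_nonneg _) hd0) hKEX
  have hCHn10nn : 0 ≤ CHn10 := by
    rw [hCHn10]
    exact add_nonneg (mul_nonneg h2 (mul_nonneg hεd (mul_nonneg hF hC10h0))) (mul_nonneg h2 (mul_nonneg hcardK (mul_nonneg hεd hCf10)))
  have hCHn01nn : 0 ≤ CHn01 := by
    rw [hCHn01]
    exact add_nonneg (mul_nonneg h2 (mul_nonneg hεd (mul_nonneg hF hC01h0))) (mul_nonneg h2 (mul_nonneg hcardK (mul_nonneg hεd hCf01)))
  have hCHt : 0 ≤ 2 * ((P.mesh 0 ^ P.d)⁻¹ * (farF P δ ρ * (C10d + C01d))) + (CHn10 + CHn01) :=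
    add_nonneg hCH (add_nonneg hCHn10nn hCHn01nn)
  have hmk' : P.mesh k = (P.L : ℝ) ^ k * P.mesh 0 := by
    have h := B3Op116CollarRows.mesh_eq_pow_mul_mesh (P := P) (Nat.zero_le k); rwa [Nat.sub_zero] at h
  have hLk : (0 : ℝ) < (P.L : ℝ) ^ k := pow_pos (by exact_mod_cast P.hL) k
  have hd1 : (1 : ℝ) ≤ (P.d : ℝ) := by exact_mod_cast P.hd
  -- far geometry in F4's shapes
  have hfar4 : ∀ x₁ x₂ x' : HiggsLattice.Site P 0, Interior k K₀ Ω₂ x₁ → Interior k K₀ Ω₂ x₂ → Interior k K₀ Ω₂ x' →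
      (∀ b : HiggsLattice.PBond P 0, (Pf b ≠ 0 ∨ Pf (pred b) ≠ 0) → Far P k ρ x₁ b.src ∧ Far P k ρ x₂ b.src ∧ Far P k ρ b.src x') ∧
      (∀ b : HiggsLattice.PBond P 0, Pf b ≠ 0 → Far P k ρ x₁ b.tgt ∧ Far P k ρ x₂ b.tgt ∧ Far P k ρ b.tgt x') ∧
      (∀ b : HiggsLattice.PBond P 0, Pf b ≠ 0 → ∀ z : HiggsLattice.Site P 0, blockIter k z = blockIter k b.src →
        Far P k ρ x₁ z ∧ Far P k ρ x₂ z) := by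
    intro x₁ x₂ x' h₁ h₂ h'
    refine ⟨fun b hb => ⟨(hfarC x₁ x' h₁ h' b hb).1.1, (hfarC x₂ x' h₂ h' b hb).1.1, (hfarC x₁ x' h₁ h' b hb).1.2⟩,
      fun b hb => ⟨(hfarC x₁ x' h₁ h' b (Or.inl hb)).2.1, (hfarC x₂ x' h₂ h' b (Or.inl hb)).2.1, (hfarC x₁ x' h₁ h' b (Or.inl hb)).2.2⟩,
      fun b hb z hz => ⟨(hfarI x₁ x' h₁ h' b hb z hz).1, (hfarI x₂ x' h₂ h' b hb z hz).1⟩⟩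
  -- near pairs: the contour stays in `Ω`, and `P` vanishes along it
  have hnearΓ : ∀ {x₁ x₂ : HiggsLattice.Site P 0} {Γ : List (HiggsLattice.Site P 0)}, Interior k K₀ Ω₂ x₁ →
      ¬ (P.mesh k ≤ P.mesh 0 * (HiggsLattice.Site.tdist x₁ x₂ : ℝ)) → IsAdm x₁ x₂ Γ →
      (HiggsLattice.Site.tdist x₁ x₂ : ℝ) ≤ (P.L : ℝ) ^ k ∧ (∀ z ∈ Γ, z ∈ Ω) ∧
      (∀ z ∈ x₁ :: Γ, ∀ ν : Fin P.d, Pf ⟨z, ν⟩ = 0) := by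
    intro x₁ x₂ Γ h₁ hnf hΓ
    have hlt : (HiggsLattice.Site.tdist x₁ x₂ : ℝ) ≤ (P.L : ℝ) ^ k := by
      rw [not_le, hmk'] at hnf
      have hε := P.mesh_pos 0
      by_contra hc
      rw [not_le] at hc
      nlinarith
    refine ⟨hlt, fun z hz => hsub (mem_of_isAdm_near hK₀ h₁ hlt hΓ z hz), fun z hz ν => hnearP x₁ h₁ z ?_ ν⟩
    rcases List.mem_cons.1 hz with rfl | hz'
    · rw [B1Ineq234Concrete.tdist_self, Nat.cast_zero]; positivity
    · have h1 := B3Op116CollarHolderBinder.tdist_le_length_of_isTChain _ Γ hΓ.1 z hz'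
      have h2 : (Γ.length : ℝ) ≤ (P.d : ℝ) * (HiggsLattice.Site.tdist x₁ x₂ : ℝ) := hΓ.2.2
      exact h1.trans (h2.trans (mul_le_mul_of_nonneg_left hlt hd0))
  -- lifting a binder constant `c ≤ C_H`
  have lift : ∀ {c θ Sx E : ℝ}, 0 ≤ θ → 0 ≤ Sx → 0 ≤ E → c ≤ 2 * ((P.mesh 0 ^ P.d)⁻¹ * (farF P δ ρ * (C10d + C01d))) + (CHn10 + CHn01) →
      θ * (c * (P.mesh k * 1) ^ (1 + 0) * Sx) * E
        ≤ θ * ((2 * ((P.mesh 0 ^ P.d)⁻¹ * (farF P δ ρ * (C10d + C01d))) + (CHn10 + CHn01)) * (P.mesh k * 1) ^ (1 + 0) * Sx) * E := by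
    intro c θ Sx E hθ hSx hE hc
    have ht0 : 0 ≤ (P.mesh k * 1) ^ (1 + 0) := by positivity
    exact mul_le_mul_of_nonneg_right (mul_le_mul_of_nonneg_left
      (mul_le_mul_of_nonneg_right (mul_le_mul_of_nonneg_right hc ht0) hSx) hθ) hE
  have hH : ∀ (μ : Fin P.d) (x₁ x₂ x' : HiggsLattice.Site P 0) (Γ : List (HiggsLattice.Site P 0)),
      Interior k K₀ Ω₂ x₁ → Interior k K₀ Ω₂ x₂ → Interior k K₀ Ω₂ x' → x₁ ≠ x₂ → IsAdm x₁ x₂ Γ →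
      (P.mesh 0 ^ P.d)⁻¹ * ∑ i' : Ix N, ‖hol C Y x₁ Γ (covDeriv C Y (op116 C Ω Pf Y msq a k 1 0 (cb P N 0 (x', i'))) ⟨x₂, μ⟩)
          - covDeriv C Y (op116 C Ω Pf Y msq a k 1 0 (cb P N 0 (x', i'))) ⟨x₁, μ⟩‖
        ≤ (P.mesh 0 * (HiggsLattice.Site.tdist x₁ x₂ : ℝ)) ^ α *
          ((2 * ((P.mesh 0 ^ P.d)⁻¹ * (farF P δ ρ * (C10d + C01d))) + (CHn10 + CHn01)) * (P.mesh k * 1) ^ (1 + 0) *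
            (P.mesh k * (P.mesh k ^ P.d)⁻¹ * (P.mesh k ^ α)⁻¹)) *
          Real.exp (-(δ / 4 * (min (HiggsLattice.Site.tdist x₁ x' : ℝ) (HiggsLattice.Site.tdist x₂ x' : ℝ) / (P.L : ℝ) ^ k))) := by
    intro μ x₁ x₂ x' Γ h₁ h₂ h' hne hΓ
    have hθ : 0 ≤ (P.mesh 0 * (HiggsLattice.Site.tdist x₁ x₂ : ℝ)) ^ α :=
      Real.rpow_nonneg (mul_nonneg (P.mesh_pos 0).le (Nat.cast_nonneg _)) α
    have hSx : 0 ≤ P.mesh k * (P.mesh k ^ P.d)⁻¹ * (P.mesh k ^ α)⁻¹ := by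
      have := Real.rpow_pos_of_pos (P.mesh_pos k) α; positivity
    have hE := Real.exp_nonneg (-(δ / 4 * (min (HiggsLattice.Site.tdist x₁ x' : ℝ) (HiggsLattice.Site.tdist x₂ x' : ℝ) / (P.L : ℝ) ^ k)))
    by_cases hnf : P.mesh k ≤ P.mesh 0 * (HiggsLattice.Site.tdist x₁ x₂ : ℝ)
    · have h := holder_far_of_deriv_row C Y (op116 C Ω Pf Y msq a k 1 0) (Interior k K₀ Ω₂) hCDt hδ4 hα0 hDv μ x₁ x₂ x' Γ h₁ h₂ h' hnf
      exact h.trans (lift hθ hSx hE (by linarith))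
    · obtain ⟨hlt, hΓΩ, hPΓ⟩ := hnearΓ h₁ hnf hΓ
      have hH2 := two_anchor_of_dict C Ω Y Y msq a hne
        (fun y hy => hhcolY μ x₁ x₂ y hne.symm (hI x₁ h₁).1 ((hI x₁ h₁).2 μ) (hI x₂ h₂).1 ((hI x₂ h₂).2 μ) hy Γ hΓ hΓΩ)
        (fun _ _ _ => rfl) rfl rfl
      have hfg := hfar4 x₁ x₂ x' h₁ h₂ h'
      have h := holder_near_currency C Ω Pf Y Y (Pf + Y) a hmsq hak hΩ hL2 hkK hδ hδ1 hρ hs hδA hcYh hcPY hcPYd' hα1.le hP hregP i₀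
        (hI x₁ h₁).1 ((hI x₁ h₁).2 μ) (hI x₂ h₂).1 ((hI x₂ h₂).2 μ) (hI x' h').1 Γ hH2
        (col_state_all C Ω (Pf + Y) a hmsq hak hΩ (hI x' h').1 hcPY fun u hu => hcolPY u x' hu (hI x' h').1)
        (fun b hb => sum_dY_le_maj C Pf Y hδ hδ1 hs hcPY hP Finset.univ
          (fun i' => propagatorK C Ω (Pf + Y) msq a k (cb P N 0 (x', i'))) b x' (hdcolPY x' (hI x' h').1 b (mem_inB.1 hb).1)
          (hcolPY b.tgt x' (mem_inB.1 hb).1.2 (hI x' h').1))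
        Fc hexF henF hfg.1 hfg.2.1 hfg.2.2
      have e : ∀ i' : Ix N, holT C Y x₁ x₂ Γ μ (propagatorK C Ω Y msq a k (srcV C Pf Y k Ω a
            (propagatorK C Ω (Pf + Y) msq a k (cb P N 0 (x', i')))))
          = hol C Y x₁ Γ (covDeriv C Y (op116 C Ω Pf Y msq a k 1 0 (cb P N 0 (x', i'))) ⟨x₂, μ⟩)
            - covDeriv C Y (op116 C Ω Pf Y msq a k 1 0 (cb P N 0 (x', i'))) ⟨x₁, μ⟩ := fun i' => by
        rw [holT_apply, op116_succ_left_apply, op116_zero_zero_apply]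
      simp only [e] at h
      refine h.trans ?_
      have hl := lift (c := CHn10) hθ hSx hE (by linarith)
      rw [ht1] at hl
      rw [ht1]
      exact hl
  have hH' : ∀ (μ : Fin P.d) (x₁ x₂ x' : HiggsLattice.Site P 0) (Γ : List (HiggsLattice.Site P 0)),
      Interior k K₀ Ω₂ x₁ → Interior k K₀ Ω₂ x₂ → Interior k K₀ Ω₂ x' → x₁ ≠ x₂ → IsAdm x₁ x₂ Γ →
      (P.mesh 0 ^ P.d)⁻¹ * ∑ i' : Ix N, ‖hol C Y x₁ Γ (covDeriv C Y (op116 C Ω Pf Y msq a k 0 1 (cb P N 0 (x', i'))) ⟨x₂, μ⟩)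
          - covDeriv C Y (op116 C Ω Pf Y msq a k 0 1 (cb P N 0 (x', i'))) ⟨x₁, μ⟩‖
        ≤ (P.mesh 0 * (HiggsLattice.Site.tdist x₁ x₂ : ℝ)) ^ α *
          ((2 * ((P.mesh 0 ^ P.d)⁻¹ * (farF P δ ρ * (C10d + C01d))) + (CHn10 + CHn01)) * (P.mesh k * 1) ^ (1 + 0) *
            (P.mesh k * (P.mesh k ^ P.d)⁻¹ * (P.mesh k ^ α)⁻¹)) *
          Real.exp (-(δ / 4 * (min (HiggsLattice.Site.tdist x₁ x' : ℝ) (HiggsLattice.Site.tdist x₂ x' : ℝ) / (P.L : ℝ) ^ k))) := by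
    intro μ x₁ x₂ x' Γ h₁ h₂ h' hne hΓ
    have hθ : 0 ≤ (P.mesh 0 * (HiggsLattice.Site.tdist x₁ x₂ : ℝ)) ^ α :=
      Real.rpow_nonneg (mul_nonneg (P.mesh_pos 0).le (Nat.cast_nonneg _)) α
    have hSx : 0 ≤ P.mesh k * (P.mesh k ^ P.d)⁻¹ * (P.mesh k ^ α)⁻¹ := by
      have := Real.rpow_pos_of_pos (P.mesh_pos k) α; positivity
    have hE := Real.exp_nonneg (-(δ / 4 * (min (HiggsLattice.Site.tdist x₁ x' : ℝ) (HiggsLattice.Site.tdist x₂ x' : ℝ) / (P.L : ℝ) ^ k)))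
    by_cases hnf : P.mesh k ≤ P.mesh 0 * (HiggsLattice.Site.tdist x₁ x₂ : ℝ)
    · have h := holder_far_of_deriv_row C Y (op116 C Ω Pf Y msq a k 0 1) (Interior k K₀ Ω₂) hCDt hδ4 hα0 hDv' μ x₁ x₂ x' Γ h₁ h₂ h' hnf
      exact h.trans (lift hθ hSx hE (by linarith))
    · obtain ⟨hlt, hΓΩ, hPΓ⟩ := hnearΓ h₁ hnf hΓ
      have hx2P : Pf ⟨x₂, μ⟩ = 0 :=
        hnearP x₁ h₁ x₂ (hlt.trans (le_mul_of_one_le_left hLk.le hd1)) μ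
      have hx1P : Pf ⟨x₁, μ⟩ = 0 := hPΓ x₁ (by simp) μ
      have hH2 := two_anchor_of_dict C Ω (Pf + Y) Y msq a hne
        (fun y hy => hhcolPY μ x₁ x₂ y hne.symm (hI x₁ h₁).1 ((hI x₁ h₁).2 μ) (hI x₂ h₂).1 ((hI x₂ h₂).2 μ) hy Γ hΓ hΓΩ)
        (fun z hz ν => by rw [Pi.add_apply, hPΓ z hz ν, zero_add])
        (by rw [Pi.add_apply, hx1P, zero_add]) (by rw [Pi.add_apply, hx2P, zero_add])
      have hfg := hfar4 x₁ x₂ x' h₁ h₂ h'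
      have h := holder_near_currency C Ω Pf Y (Pf + Y) Y a hmsq hak hΩ hL2 hkK hδ hδ1 hρ hs hδA hcPYh hcY hcYd hα1.le hP hregP i₀
        (hI x₁ h₁).1 ((hI x₁ h₁).2 μ) (hI x₂ h₂).1 ((hI x₂ h₂).2 μ) (hI x' h').1 Γ hH2
        (col_state_all C Ω Y a hmsq hak hΩ (hI x' h').1 hcY fun u hu => hcolY u x' hu (hI x' h').1)
        (fun b hb => hdcolY x' (hI x' h').1 b (mem_inB.1 hb).1)
        Fc hexF henF hfg.1 hfg.2.1 hfg.2.2
      have e : ∀ i' : Ix N, holT C Y x₁ x₂ Γ μ (propagatorK C Ω (Pf + Y) msq a k (srcV C Pf Y k Ω a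
            (propagatorK C Ω Y msq a k (cb P N 0 (x', i')))))
          = hol C Y x₁ Γ (covDeriv C Y (op116 C Ω Pf Y msq a k 0 1 (cb P N 0 (x', i'))) ⟨x₂, μ⟩)
            - covDeriv C Y (op116 C Ω Pf Y msq a k 0 1 (cb P N 0 (x', i'))) ⟨x₁, μ⟩ := fun i' => by
        rw [holT_apply, op116_succ_right_apply, op116_zero_zero_apply]
      simp only [e] at h
      refine h.trans ?_
      have hl := lift (c := CHn01) hθ hSx hE (by linarith)
      rw [ht1] at hl
      rw [ht1]
      exact hl
  have hA := ineq25At_op116_smooth_of_bounds_inner hL2 hk1 hkK 1 0 hα0 hα1.le hc₁ hc₂ ht hCG hδ4 hCV hCD hCHt hCM hδG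
    hV hV' hDv hDv' hH hH' hM hM'
  -- the order `(n,n′) = (0,1)`: the same eight binders with the roles of the two alternatives exchanged
  have n01 : ∀ {c S E : ℝ}, c * (P.mesh k * 1) ^ (0 + 1) * S * E = c * (P.mesh k * 1) ^ (1 + 0) * S * E := by
    intros; norm_num
  have n01' : ∀ {θ c S E : ℝ}, θ * (c * (P.mesh k * 1) ^ (0 + 1) * S) * E = θ * (c * (P.mesh k * 1) ^ (1 + 0) * S) * E := by
    intros; norm_num
  have hA' := ineq25At_op116_smooth_of_bounds_inner hL2 hk1 hkK 0 1 hα0 hα1.le hc₁ hc₂ ht hCG hδ4 hCV hCD hCHt hCM hδG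
    (fun x x' hx hx' => by rw [n01]; exact hV' x x' hx hx') (fun x x' hx hx' => by rw [n01]; exact hV x x' hx hx')
    (fun μ x x' hx hx' => by rw [n01]; exact hDv' μ x x' hx hx') (fun μ x x' hx hx' => by rw [n01]; exact hDv μ x x' hx hx')
    (fun μ x₁ x₂ x' Γ h₁ h₂ h' hne hΓ => by rw [n01']; exact hH' μ x₁ x₂ x' Γ h₁ h₂ h' hne hΓ)
    (fun μ x₁ x₂ x' Γ h₁ h₂ h' hne hΓ => by rw [n01']; exact hH μ x₁ x₂ x' Γ h₁ h₂ h' hne hΓ)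
    (fun μ ν x x' hx hx' => by rw [n01]; exact hM' μ ν x x' hx hx') (fun μ ν x x' hx hx' => by rw [n01]; exact hM μ ν x x' hx hx')
  constructor
  · convert hA using 2
    rw [hCHn10, hCHn01]
    ring
  · convert hA' using 2
    rw [hCHn10, hCHn01]
    ring

end MemberHolder

/-! ## §3 The (C)-level discharge on a cell-product box at `0 ≤ α < 1` -/

section BoxHolder

open scoped Classical

open B1TorusCubeCover (half)
open B1TorusRegionHSizes (IsBigBlockUnion)
open B1Ineq225RegularBox (cellBox isBigBlockUnion_cellBox)
open B3Ineq25SmoothLocalization (ineq25_smooth_regularNested)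
open B3Ineq210RegularRegion (blockUnion_of_isBigBlockUnion)
open B3Op116BoxRows (colB_dcolB_le hcolB_le)
open B3Op116CollarDict (mixedB_le)
open B3Op116MajorantStep (maj_rate_mono)

/-- the two-anchor sum of `hcolB_le` is two majorants. [cite: Balaban1983Higgs3, (2.11) p.426] -/
theorem sum_two_anchor_eq_maj (k : ℕ) (c aK δ : ℝ) (x₁ x₂ y : HiggsLattice.Site P 0) :
    ∑ j ∈ Finset.range k, c * P.mesh j ^ (aK - (P.d : ℝ)) *
        (Real.exp (-(δ * (P.mesh j)⁻¹ * (P.mesh 0 * (HiggsLattice.Site.tdist x₁ y : ℝ)))) +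
          Real.exp (-(δ * (P.mesh j)⁻¹ * (P.mesh 0 * (HiggsLattice.Site.tdist x₂ y : ℝ)))))
      = maj P k c aK δ x₁ y + maj P k c aK δ x₂ y := by
  unfold maj
  rw [← Finset.sum_add_distrib]
  exact Finset.sum_congr rfl fun j _ => mul_add _ _ _

set_option maxHeartbeats 1600000 in
/-- **INEQUALITY (2.5) AT `(n,n′) = (1,0)`, HÖLDER EXPONENT `0 ≤ α < 1`, FOR THE ONE-`V_k` COLLAR OPERATOR ON A CELL-PRODUCT BOX
`Ω = cellBox k K₀ S`, FROM THE TREE'S DICTIONARY** — §2's member with its six (2.10) families discharged by p35's `colB_dcolB_le` and p40's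
`mixedB_le`, its two (2.11) two-anchor families by p35's `hcolB_le` (for `Y` and for `P + Y`), and the `δG_k` clause by p33's
`ineq25_smooth_regularNested` at `α`, at a common cube size and rate: ∃ `E₀ > 0` ∀ charge with `e² ≤ E₀` ∃ `K₀,min` ∀ `0 ≤ α < 1` ∀ `K₀ ≥ K₀,min`
∃ `t, δ, δ₀, C_G` such that for every volume, every `1 ≤ k ≤ K`, every `S`, every big-block union `Ω₂ ⊆ Ω`, all `Y, P` (regularity of `Y`,
`P + Y`, `P`, smallness, `sup|P| ≤ s`, `ρ ≥ 1`), every face family covering the endpoints in `Ω` of the crossing bonds of `supp P`, and the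
far/near GEOMETRY of `supp P` relative to the interior points of `Ω₂`, there is `K ≥ 0` with
`(sect2Smooth116 … P Y … (L^kε) 1).Ineq25At 1 0 α (min δ₀ (δ/4)) (C_G + (ε^d)^{-1}·farF(δ,ρ)·K)` (and the order (0,1)).
[cite: Balaban1983Higgs3, (2.5) p.424, (1.16) p.414, (2.10) p.426, (2.11) p.426, p.433] [cite: Balaban1982Higgs1, Prop. 2.1 p.610, (3.16) p.615] [cite: Balaban1983RegularityDecay, Theorem p.573] -/
theorem ineq25At_one_zero_collarBox_holder (d L : ℕ) (hd : 1 ≤ d) (hL : 2 ≤ L) {a : ℝ} (ha : 0 < a) {msq : ℝ} (hmsq : 0 < msq)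
    {c : ℝ} (hc : 0 ≤ c) (N m : ℕ) {c₁ c₂ : ℝ} (hc₁ : 0 ≤ c₁) (hc₂ : 0 ≤ c₂) :
    ∃ E₀ : ℝ, 0 < E₀ ∧ ∀ (C : ChargeData N), C.e ^ 2 ≤ E₀ →
      ∃ K₀min : ℕ, ∀ {α : ℝ}, 0 ≤ α → α < 1 → ∀ K₀ : ℕ, K₀min ≤ K₀ → ∃ t δ δ₀ CG : ℝ, 0 < t ∧ 0 < δ ∧ δ ≤ 1 ∧ 0 < δ₀ ∧ 0 ≤ CG ∧
      ∀ (P : HiggsLattice.Params) (hP1 : 1 < P.L), P.d = d → P.L = L → K₀ ∣ P.M →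
      ∀ {k : ℕ}, 1 ≤ k → k ≤ P.K → (∀ μ, 3 * half P k K₀ ≤ P.sitesPerDir 0 μ) → P.mesh k ≤ 1 →
      ∀ (S : Fin P.d → Finset ℕ) (Ω₂ : Finset (HiggsLattice.Site P 0)), IsBigBlockUnion k K₀ Ω₂ → Ω₂ ⊆ cellBox k K₀ S →
      ∀ (Pf Y : HiggsLattice.VecField P 0) {δY δPY δP s ρ : ℝ}, 0 ≤ δY → 0 ≤ δPY → 0 ≤ δP → 0 ≤ s → 1 ≤ ρ →
        (∀ z ∈ cellBox k K₀ S, ∀ μ ν : Fin P.d, |Y ⟨z.shift ν, μ⟩ - Y ⟨z, μ⟩| ≤ δY) →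
        (∀ z ∈ cellBox k K₀ S, ∀ μ ν : Fin P.d, |(Pf + Y) ⟨z.shift ν, μ⟩ - (Pf + Y) ⟨z, μ⟩| ≤ δPY) →
        (∀ (z : HiggsLattice.Site P 0) (μ ν : Fin P.d), |Pf ⟨z.shift ν, μ⟩ - Pf ⟨z, μ⟩| ≤ δP) →
        (P.L : ℝ) ^ k * δY * |C.e| ≤ t → (P.L : ℝ) ^ k * δPY * |C.e| ≤ t → (P.L : ℝ) ^ k * δY ≤ c * |C.e| →
        (∀ b : HiggsLattice.PBond P 0, |Pf b| ≤ s) →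
      ∀ (Fc : Finset (Σ ν : Fin P.d, ZMod (P.sitesPerDir 0 ν))),
        (∀ b ∈ exB (cellBox k K₀ S) Pf, ∃ f ∈ Fc, b.src f.1 = f.2) → (∀ b ∈ enB (cellBox k K₀ S) Pf, ∃ f ∈ Fc, b.tgt f.1 = f.2) →
        (∀ x x' : HiggsLattice.Site P 0, Interior k K₀ Ω₂ x → Interior k K₀ Ω₂ x' →
          ∀ b : HiggsLattice.PBond P 0, Pf b ≠ 0 → ∀ z : HiggsLattice.Site P 0, blockIter k z = blockIter k b.src →
            Far P k ρ x z ∧ Far P k ρ z x') →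
        (∀ x x' : HiggsLattice.Site P 0, Interior k K₀ Ω₂ x → Interior k K₀ Ω₂ x' →
          ∀ b : HiggsLattice.PBond P 0, (Pf b ≠ 0 ∨ Pf (pred b) ≠ 0) →
            (Far P k ρ x b.src ∧ Far P k ρ b.src x') ∧ (Far P k ρ x b.tgt ∧ Far P k ρ b.tgt x')) →
        (∀ x : HiggsLattice.Site P 0, Interior k K₀ Ω₂ x →
          ∀ z : HiggsLattice.Site P 0, (HiggsLattice.Site.tdist x z : ℝ) ≤ (P.d : ℝ) * (P.L : ℝ) ^ k → ∀ ν : Fin P.d, Pf ⟨z, ν⟩ = 0) →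
      ∀ r₀ : ℕ, Ix N →
        ∃ K : ℝ, 0 ≤ K ∧
          (sect2Smooth116 hP1 C (cellBox k K₀ S) Ω₂ Pf Y msq a k K₀ r₀ m c₁ c₂ (P.mesh k) 1).Ineq25At 1 0 α (min δ₀ (δ / 4))
            (CG + (P.mesh 0 ^ P.d)⁻¹ * farF P δ ρ * K) ∧
          (sect2Smooth116 hP1 C (cellBox k K₀ S) Ω₂ Pf Y msq a k K₀ r₀ m c₁ c₂ (P.mesh k) 1).Ineq25At 0 1 α (min δ₀ (δ / 4))
            (CG + (P.mesh 0 ^ P.d)⁻¹ * farF P δ ρ * K) := by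
  obtain ⟨E₀, hE₀, hG⟩ := ineq25_smooth_regularNested d L hd hL ha hmsq hc N m hc₁ hc₂
  refine ⟨E₀, hE₀, fun C heC => ?_⟩
  obtain ⟨K₃, hK₃⟩ := hG C heC
  obtain ⟨K₁, hK₁⟩ := colB_dcolB_le d L hd hL ha hmsq N C
  obtain ⟨K₂, hK₂⟩ := mixedB_le d L hd hL ha hmsq N C
  obtain ⟨K₄, hK₄⟩ := hcolB_le d L hd hL ha hmsq N C
  refine ⟨max (max (max K₁ K₂) (max K₃ K₄)) 1, fun {α} hα0 hα1 K₀ hK₀ => ?_⟩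
  have hK₀1 : 1 ≤ K₀ := (le_max_right _ _).trans hK₀
  obtain ⟨t₁, δ₁, C₁, ht₁, hδ₁, hC₁, h1⟩ :=
    hK₁ K₀ ((le_max_left K₁ K₂).trans ((le_max_left _ _).trans ((le_max_left _ _).trans hK₀)))
  obtain ⟨t₂, δ₂, C₂, ht₂, hδ₂, hC₂, h2⟩ :=
    hK₂ K₀ ((le_max_right K₁ K₂).trans ((le_max_left _ _).trans ((le_max_left _ _).trans hK₀)))
  obtain ⟨t₃, δ₃, C₃, ht₃, hδ₃, hC₃, h3⟩ :=
    hK₃ hα0 hα1 K₀ ((le_max_left K₃ K₄).trans ((le_max_right _ _).trans ((le_max_left _ _).trans hK₀)))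
  obtain ⟨t₄, δ₄, C₄, ht₄, hδ₄, hC₄, h4⟩ :=
    hK₄ hα0 hα1 K₀ ((le_max_right K₃ K₄).trans ((le_max_right _ _).trans ((le_max_left _ _).trans hK₀)))
  -- the common smallness threshold and the common rate
  set t : ℝ := min (min t₁ t₂) (min t₃ t₄) with htdef
  set δ : ℝ := min (min δ₁ δ₂) (min δ₄ 1) with hδdef
  have htt₁ : t ≤ t₁ := (min_le_left _ _).trans (min_le_left _ _)
  have htt₂ : t ≤ t₂ := (min_le_left _ _).trans (min_le_right _ _)
  have htt₃ : t ≤ t₃ := (min_le_right _ _).trans (min_le_left _ _)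
  have htt₄ : t ≤ t₄ := (min_le_right _ _).trans (min_le_right _ _)
  have hδδ₁ : δ ≤ δ₁ := (min_le_left _ _).trans (min_le_left _ _)
  have hδδ₂ : δ ≤ δ₂ := (min_le_left _ _).trans (min_le_right _ _)
  have hδδ₄ : δ ≤ δ₄ := (min_le_right _ _).trans (min_le_left _ _)
  have hδ1 : δ ≤ 1 := (min_le_right _ _).trans (min_le_right _ _)
  have hδ0 : 0 < δ := lt_min (lt_min hδ₁ hδ₂) (lt_min hδ₄ one_pos)
  refine ⟨t, δ, δ₃, C₃, lt_min (lt_min ht₁ ht₂) (lt_min ht₃ ht₄), hδ0, hδ1, hδ₃, hC₃.le, ?_⟩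
  intro P hP1 hPd hPL hK₀M k hk hkK h3h hmesh S Ω₂ hΩ₂ hsub Pf Y δY δPY δP s ρ hδY hδPY hδP hs hρ hregY hregPY hregP htY htPY hcY hP
    Fc hexF henF hfarI hfarC hnearP r₀ i₀
  have hL2 : 2 ≤ P.L := by rw [hPL]; exact hL
  have hε := P.mesh_pos 0
  have hεd : 0 ≤ P.mesh 0 ^ P.d := pow_nonneg hε.le _
  have hcC₁ : 0 ≤ P.mesh 0 ^ P.d * C₁ := mul_nonneg hεd hC₁.le
  have hcC₂ : 0 ≤ P.mesh 0 ^ P.d * C₂ := mul_nonneg hεd hC₂.le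
  have hcC₄ : 0 ≤ P.mesh 0 ^ P.d * C₄ := mul_nonneg hεd hC₄.le
  have hak : 0 ≤ B1.aSeq a P.L k := (B1.aSeq_pos ha (by exact_mod_cast hP1) hk).le
  have hΩ : ∀ x x' : HiggsLattice.Site P 0, blockIter k x = blockIter k x' → (x ∈ cellBox k K₀ S ↔ x' ∈ cellBox k K₀ S) :=
    blockUnion_of_isBigBlockUnion le_rfl (isBigBlockUnion_cellBox S)
  -- the (2.10) dictionary of `G_k(Ω,X)` for `X = Y` and `X = P + Y`, at the common rate
  have hdict : ∀ (X : HiggsLattice.VecField P 0) {δX : ℝ}, 0 ≤ δX →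
      (∀ z ∈ cellBox k K₀ S, ∀ μ ν : Fin P.d, |X ⟨z.shift ν, μ⟩ - X ⟨z, μ⟩| ≤ δX) → (P.L : ℝ) ^ k * δX * |C.e| ≤ t →
      (∀ u y : HiggsLattice.Site P 0, u ∈ cellBox k K₀ S → y ∈ cellBox k K₀ S →
        ∑ i : Ix N, ‖propagatorK C (cellBox k K₀ S) X msq a k (cb P N 0 (y, i)) u‖ ≤ maj P k (P.mesh 0 ^ P.d * C₁) 2 δ u y) ∧
      (∀ y ∈ cellBox k K₀ S, ∀ b : HiggsLattice.PBond P 0, Inside (cellBox k K₀ S) b →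
        ∑ i : Ix N, ‖covDeriv C X (propagatorK C (cellBox k K₀ S) X msq a k (cb P N 0 (y, i))) b‖
          ≤ maj P k (P.mesh 0 ^ P.d * C₁) 1 δ b.src y) ∧
      (∀ b b' : HiggsLattice.PBond P 0, Inside (cellBox k K₀ S) b → Inside (cellBox k K₀ S) b' →
        (P.mesh 0)⁻¹ * ∑ i : Ix N, ‖covDeriv C X (propagatorK C (cellBox k K₀ S) X msq a k (dip C X b' (onb N i))) b‖
          ≤ maj P k (P.mesh 0 ^ P.d * C₂) 0 δ b.src b'.src) ∧
      (∀ (μ : Fin P.d) (x₁ x₂ y : HiggsLattice.Site P 0), x₂ ≠ x₁ → x₁ ∈ cellBox k K₀ S → x₁.shift μ ∈ cellBox k K₀ S →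
        x₂ ∈ cellBox k K₀ S → x₂.shift μ ∈ cellBox k K₀ S → y ∈ cellBox k K₀ S →
        ∀ Γ : List (HiggsLattice.Site P 0), IsAdm x₁ x₂ Γ → (∀ z ∈ Γ, z ∈ cellBox k K₀ S) →
        (∑ i : Ix N, ‖hol C X x₁ Γ (covDeriv C X (propagatorK C (cellBox k K₀ S) X msq a k (cb P N 0 (y, i))) ⟨x₂, μ⟩)
            - covDeriv C X (propagatorK C (cellBox k K₀ S) X msq a k (cb P N 0 (y, i))) ⟨x₁, μ⟩‖)
            / (P.mesh 0 * (HiggsLattice.Site.tdist x₁ x₂ : ℝ)) ^ α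
          ≤ maj P k (P.mesh 0 ^ P.d * C₄) (1 - α) δ x₁ y + maj P k (P.mesh 0 ^ P.d * C₄) (1 - α) δ x₂ y) := by
    intro X δX hδX hregX htX
    have hh := fun x y hx hy => h1 P hP1 hPd hPL hK₀M hk hkK h3h hmesh S X hδX hregX (htX.trans htt₁) x y hx hy
    refine ⟨fun u y hu hy => ?_, fun y hy b hb => ?_, fun b b' hb hb' => ?_, fun μ x₁ x₂ y hne hx₁ hx₁μ hx₂ hx₂μ hy Γ hΓ hΓΩ => ?_⟩
    · exact ((hh u y hu hy).1).trans (maj_rate_mono hcC₁ hδδ₁ u y)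
    · exact ((hh b.src y hb.1 hy).2 b.dir hb.2).trans (maj_rate_mono hcC₁ hδδ₁ b.src y)
    · exact (h2 P hP1 hPd hPL hK₀M hk hkK h3h hmesh S X hδX hregX (htX.trans htt₂) b.dir b'.dir b.src b'.src hb.1 hb.2 hb'.1
        hb'.2).trans (maj_rate_mono hcC₂ hδδ₂ b.src b'.src)
    · have h := h4 P hP1 hPd hPL hK₀M hk hkK h3h hmesh S X hδX hregX (htX.trans htt₄) μ x₁ x₂ y hne hx₁ hx₁μ hx₂ hx₂μ hy Γ hΓ hΓΩ
      rw [sum_two_anchor_eq_maj] at h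
      exact h.trans (add_le_add (maj_rate_mono hcC₄ hδδ₄ x₁ y) (maj_rate_mono hcC₄ hδδ₄ x₂ y))
  obtain ⟨hcolY, hdcolY, hmixY, hhcolY⟩ := hdict Y hδY hregY htY
  obtain ⟨hcolPY, hdcolPY, hmixPY, hhcolPY⟩ := hdict (Pf + Y) hδPY hregPY htPY
  -- the `δG_k(Ω,Ω₂,Y)` clause with smooth localizations at `α`
  have hδG : (sect2DeltaSmooth hP1 C (cellBox k K₀ S) Ω₂ Y msq a k K₀ r₀ m c₁ c₂).Ineq25 α δ₃ C₃ :=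
    h3 P hP1 hPd hPL hK₀M hk hkK h3h hmesh (cellBox k K₀ S) Ω₂ (isBigBlockUnion_cellBox S) hΩ₂ hsub Y hδY hregY (htY.trans htt₃) hcY r₀
  have hI : ∀ x : HiggsLattice.Site P 0, Interior k K₀ Ω₂ x → x ∈ cellBox k K₀ S ∧ ∀ μ : Fin P.d, x.shift μ ∈ cellBox k K₀ S :=
    fun x hx => ⟨hsub hx.mem, fun μ => hsub (hx.shift_mem μ)⟩
  have hmem := ineq25At_one_zero_collar_holder_of_dict (K₀ := K₀) (r₀ := r₀) (m := m) (hL1 := hP1) (c₁ := c₁) (c₂ := c₂) C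
    (cellBox k K₀ S) Ω₂ Pf Y a hmsq hak hΩ hL2 hk hkK hK₀1 hδ0 hδ1 hρ hs hcC₁ hcC₁ hcC₂ hcC₁ hcC₁ hcC₂ hP i₀ hc₁ hc₂ hC₃.le hα0 hα1
    hδP hcC₄ hcC₄ hregP hδG hhcolY hhcolPY Fc hexF henF hcolY hdcolY hmixY hcolPY hdcolPY hmixPY hsub hI hfarI hfarC hnearP
  refine ⟨_, ?_, hmem⟩
  -- nonnegativity of the constant
  have hF : 0 ≤ farF P δ ρ := (farF_pos hδ0 ρ).le
  have hES : 0 ≤ |C.e| * s := mul_nonneg (abs_nonneg _) hs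
  have hNC : 0 ≤ (Fintype.card (Ix N) : ℝ) := Nat.cast_nonneg _
  have hmk : 0 ≤ P.mesh k := (P.mesh_pos k).le
  have he1 : 0 ≤ Real.exp 1 := (Real.exp_pos 1).le
  have hm0 := B3Op116CollarSources.avgM_nonneg (P := P) C k hs
  have hκ₄0 : 0 ≤ |B1.aSeq a P.L k| * (P.mesh k)⁻¹ ^ 2 *
      ((|C.e| * s * P.mesh 0 * (P.d * ((P.L : ℝ) ^ k - 1))) * (2 + |C.e| * s * P.mesh 0 * (P.d * ((P.L : ℝ) ^ k - 1)))) := by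
    positivity
  have hsm : 0 ≤ smoothConst P.d m c₁ (c₂ + 2 * c₁) := (B3Ineq31SmoothLocalization.smoothConst_pos P.d m hc₁ (by positivity)).le
  have hd0 : (0 : ℝ) ≤ (P.d : ℝ) := Nat.cast_nonneg _
  have hm' : (0 : ℝ) ≤ (m : ℝ) := Nat.cast_nonneg _
  have hκ₂0 : 0 ≤ (P.mesh 0)⁻¹ * (|C.e| * δP) := by positivity
  have hεdi : 0 ≤ (P.mesh 0 ^ P.d)⁻¹ := inv_nonneg.mpr hεd
  have hfC : 0 ≤ farC P δ := (farC_pos (P := P) hδ0).le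
  have hfaceC : 0 ≤ faceC P (δ / 2) := faceC_nonneg (by positivity)
  have hKEX : 0 ≤ (((P.mesh 0)⁻¹ * (|C.e| * δP) + (P.mesh 0)⁻¹ * (|C.e| * s)) + (3 * ((P.mesh 0)⁻¹ * (|C.e| * s)) + 2 * (|C.e| * s) ^ 2)) := by
    positivity
  have hcard : 0 ≤ (Fc.card : ℝ) := Nat.cast_nonneg _
  have c1 := collarC_nonneg (N := N) (aK := 2) (aKd := 1) hP1 k hδ0 (by norm_num : (0 : ℝ) < 2) hcC₁ hcC₁ hcC₁ (by positivity : 0 ≤ P.mesh 0 ^ P.d * C₁ +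
    Real.exp 1 * (P.mesh 0 ^ P.d * C₁) * P.mesh k * (|C.e| * s)) hES le_rfl (pow_nonneg hES 2) hES le_rfl hκ₄0
  have c2 := collarC_nonneg (N := N) (aK := 2) (aKd := 1) hP1 k hδ0 (by norm_num : (0 : ℝ) < 2) hcC₁ (by positivity : 0 ≤ P.mesh 0 ^ P.d * C₁ +
    Real.exp 1 * (P.mesh 0 ^ P.d * C₁) * P.mesh k * (|C.e| * s)) hcC₁ hcC₁ hES le_rfl (pow_nonneg hES 2) hES le_rfl hκ₄0
  have c3 := collarC_nonneg (N := N) (aK := 1) (aKd := 0) hP1 k hδ0 (by norm_num : (0 : ℝ) < 2) hcC₁ hcC₂ hcC₁ (by positivity : 0 ≤ P.mesh 0 ^ P.d * C₁ +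
    Real.exp 1 * (P.mesh 0 ^ P.d * C₁) * P.mesh k * (|C.e| * s)) hES le_rfl (pow_nonneg hES 2) hES le_rfl hκ₄0
  have c4 := collarC_nonneg (N := N) (aK := 1) (aKd := 0) hP1 k hδ0 (by norm_num : (0 : ℝ) < 2) hcC₁ (by positivity : 0 ≤ P.mesh 0 ^ P.d * C₂ +
    Real.exp 1 * (P.mesh 0 ^ P.d * C₁) * P.mesh k * (|C.e| * s * (Fintype.card (Ix N) : ℝ))) hcC₁ hcC₁ hES le_rfl (pow_nonneg hES 2)
    hES le_rfl hκ₄0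
  have c5 := collarC_nonneg (N := N) (aK := 1) (aKd := 0) hP1 k hδ0 (by norm_num : (0 : ℝ) < 1) hcC₁ hcC₂ (mul_nonneg hNC hcC₁) (by positivity : 0 ≤
    P.mesh 0 ^ P.d * C₂ + Real.exp 1 * (P.mesh 0 ^ P.d * C₁) * P.mesh k * (|C.e| * s * (Fintype.card (Ix N) : ℝ))) hES le_rfl
    (pow_nonneg hES 2) hES le_rfl hκ₄0
  have c6 := collarC_nonneg (N := N) (aK := 1) (aKd := 0) hP1 k hδ0 (by norm_num : (0 : ℝ) < 1) hcC₁ (by positivity : 0 ≤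
    P.mesh 0 ^ P.d * C₂ + Real.exp 1 * (P.mesh 0 ^ P.d * C₁) * P.mesh k * (|C.e| * s * (Fintype.card (Ix N) : ℝ)))
    (mul_nonneg hNC hcC₁) hcC₂ hES le_rfl (pow_nonneg hES 2) hES le_rfl hκ₄0
  have c7 := collarC_nonneg (N := N) (aK := 1 - α) (aKd := 0) hP1 k hδ0 (by norm_num : (0 : ℝ) < 2) hcC₄ le_rfl hcC₁ (by positivity : 0 ≤
    P.mesh 0 ^ P.d * C₁ + Real.exp 1 * (P.mesh 0 ^ P.d * C₁) * P.mesh k * (|C.e| * s)) hES hκ₂0 (pow_nonneg hES 2) le_rfl le_rfl hκ₄0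
  have c8 := collarC_nonneg (N := N) (aK := 1 - α) (aKd := 0) hP1 k hδ0 (by norm_num : (0 : ℝ) < 2) hcC₄ le_rfl hcC₁ hcC₁ hES hκ₂0
    (pow_nonneg hES 2) le_rfl le_rfl hκ₄0
  have f1 : 0 ≤ farF P δ ρ * (P.mesh 0 ^ P.d * C₄) * (farC P δ * (P.mesh 0 ^ P.d * C₁)) * faceC P (δ / 2) :=
    mul_nonneg (mul_nonneg (mul_nonneg hF hcC₄) (mul_nonneg hfC hcC₁)) hfaceC
  have h2' : (0 : ℝ) ≤ 2 := by norm_num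
  have hcardK : 0 ≤ (Fc.card : ℝ) * P.d *
      (((P.mesh 0)⁻¹ * (|C.e| * δP) + (P.mesh 0)⁻¹ * (|C.e| * s)) + (3 * ((P.mesh 0)⁻¹ * (|C.e| * s)) + 2 * (|C.e| * s) ^ 2)) :=
    mul_nonneg (mul_nonneg hcard hd0) hKEX
  have f10 : 0 ≤ (P.mesh 0 ^ P.d * C₄) * (farC P δ * (P.mesh 0 ^ P.d * C₁)) * faceC P (δ / 2) :=
    mul_nonneg (mul_nonneg hcC₄ (mul_nonneg hfC hcC₁)) hfaceC
  have hn10 := add_nonneg (mul_nonneg h2' c7) (mul_nonneg h2' (mul_nonneg hcardK f10))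
  have hn01 := add_nonneg (mul_nonneg h2' c8) (mul_nonneg h2' (mul_nonneg hcardK f10))
  apply_rules [add_nonneg, mul_nonneg, hsm, h2', hd0, hm', c1, c2, c3, c4, c5, c6, c7, c8, f10, hcardK, hn10, hn01]

end BoxHolder

/-! ## §4 The class-(c) member: configuration data from one support condition -/

section ClassC

open scoped Classical

open B1TorusCubeCover (half)
open B1TorusRegionHSizes (IsBigBlockUnion)
open B1Ineq225RegularBox (cellBox)
open B3Op116CollarBoxFaces (faces exists_face_of_mem_exB exists_face_of_mem_enB)
open B3Op116CollarConfig (farI_of_supp farC_of_supp nearP_of_supp)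

/-- **INEQUALITY (2.5) AT `(n,n′) = (1,0)`, `0 ≤ α < 1`, FOR THE COLLAR OPERATOR OF A CLASS-(c) CONFIGURATION ON A CELL-PRODUCT BOX** —
§3 with its configuration hypotheses DISCHARGED: the face family is `faces k K₀ S` (`B3Op116CollarBoxFaces`), and the far/near geometry
comes from ONE support condition on `P` (the cell's Route δ condition on the collar part `P = B̃′(1−χ)`, G-B3-16.A1 — not a printed
sentence; p. 433 prints `B̃ = B̃₀ + B̃′` with `|B̃ − B̃₀| ≤ O(r(L^kε)p(L^kε))` on `□`), relative to the interior points of `Ω₂`: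
`∀ b, P(b) ≠ 0 → ∀ x, Interior_k(Ω₂) x → R ≤ |x − b₋|` with `ρL^k + L^k ≤ R` and `dL^k < R` (`B3Op116CollarConfig`).  Remaining data: regularity of `Y`, `P + Y`, `P`, smallness, `sup|P| ≤ s`, `ρ ≥ 1`.
[cite: Balaban1983Higgs3, (2.5) p.424, (1.16) p.414, p.433 l.12–15] [cite: Balaban1982Higgs1, Prop. 2.1 p.610–611, (3.16) p.615] -/
theorem ineq25At_one_zero_collarBox_classC (d L : ℕ) (hd : 1 ≤ d) (hL : 2 ≤ L) {a : ℝ} (ha : 0 < a) {msq : ℝ} (hmsq : 0 < msq)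
    {c : ℝ} (hc : 0 ≤ c) (N m : ℕ) {c₁ c₂ : ℝ} (hc₁ : 0 ≤ c₁) (hc₂ : 0 ≤ c₂) :
    ∃ E₀ : ℝ, 0 < E₀ ∧ ∀ (C : ChargeData N), C.e ^ 2 ≤ E₀ →
      ∃ K₀min : ℕ, ∀ {α : ℝ}, 0 ≤ α → α < 1 → ∀ K₀ : ℕ, K₀min ≤ K₀ → ∃ t δ δ₀ CG : ℝ, 0 < t ∧ 0 < δ ∧ δ ≤ 1 ∧ 0 < δ₀ ∧ 0 ≤ CG ∧
      ∀ (P : HiggsLattice.Params) (hP1 : 1 < P.L), P.d = d → P.L = L → K₀ ∣ P.M →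
      ∀ {k : ℕ}, 1 ≤ k → k ≤ P.K → (∀ μ, 3 * half P k K₀ ≤ P.sitesPerDir 0 μ) → P.mesh k ≤ 1 →
      ∀ (S : Fin P.d → Finset ℕ) (Ω₂ : Finset (HiggsLattice.Site P 0)), IsBigBlockUnion k K₀ Ω₂ → Ω₂ ⊆ cellBox k K₀ S →
      ∀ (Pf Y : HiggsLattice.VecField P 0) {δY δPY δP s ρ R : ℝ}, 0 ≤ δY → 0 ≤ δPY → 0 ≤ δP → 0 ≤ s → 1 ≤ ρ →
        (∀ z ∈ cellBox k K₀ S, ∀ μ ν : Fin P.d, |Y ⟨z.shift ν, μ⟩ - Y ⟨z, μ⟩| ≤ δY) →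
        (∀ z ∈ cellBox k K₀ S, ∀ μ ν : Fin P.d, |(Pf + Y) ⟨z.shift ν, μ⟩ - (Pf + Y) ⟨z, μ⟩| ≤ δPY) →
        (∀ (z : HiggsLattice.Site P 0) (μ ν : Fin P.d), |Pf ⟨z.shift ν, μ⟩ - Pf ⟨z, μ⟩| ≤ δP) →
        (P.L : ℝ) ^ k * δY * |C.e| ≤ t → (P.L : ℝ) ^ k * δPY * |C.e| ≤ t → (P.L : ℝ) ^ k * δY ≤ c * |C.e| →
        (∀ b : HiggsLattice.PBond P 0, |Pf b| ≤ s) →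
        ρ * (P.L : ℝ) ^ k + (P.L : ℝ) ^ k ≤ R → (P.d : ℝ) * (P.L : ℝ) ^ k < R →
        (∀ b : HiggsLattice.PBond P 0, Pf b ≠ 0 → ∀ x : HiggsLattice.Site P 0, Interior k K₀ Ω₂ x →
          R ≤ (HiggsLattice.Site.tdist x b.src : ℝ)) →
      ∀ r₀ : ℕ, Ix N →
        ∃ K : ℝ, 0 ≤ K ∧
          (sect2Smooth116 hP1 C (cellBox k K₀ S) Ω₂ Pf Y msq a k K₀ r₀ m c₁ c₂ (P.mesh k) 1).Ineq25At 1 0 α (min δ₀ (δ / 4))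
            (CG + (P.mesh 0 ^ P.d)⁻¹ * farF P δ ρ * K) ∧
          (sect2Smooth116 hP1 C (cellBox k K₀ S) Ω₂ Pf Y msq a k K₀ r₀ m c₁ c₂ (P.mesh k) 1).Ineq25At 0 1 α (min δ₀ (δ / 4))
            (CG + (P.mesh 0 ^ P.d)⁻¹ * farF P δ ρ * K) := by
  obtain ⟨E₀, hE₀, hG⟩ := ineq25At_one_zero_collarBox_holder d L hd hL ha hmsq hc N m hc₁ hc₂
  refine ⟨E₀, hE₀, fun C heC => ?_⟩
  obtain ⟨K₀min, h⟩ := hG C heC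
  refine ⟨K₀min, fun {α} hα0 hα1 K₀ hK₀ => ?_⟩
  obtain ⟨t, δ, δ₀, CG, ht, hδ, hδ1, hδ₀, hCG, h⟩ := h hα0 hα1 K₀ hK₀
  refine ⟨t, δ, δ₀, CG, ht, hδ, hδ1, hδ₀, hCG, ?_⟩
  intro P hP1 hPd hPL hK₀M k hk hkK h3h hmesh S Ω₂ hΩ₂ hsub Pf Y δY δPY δP s ρ R hδY hδPY hδP hs hρ hregY hregPY hregP htY htPY hcY hP
    hRfar hRnear hsupp r₀ i₀
  have hL2 : 2 ≤ P.L := by rw [hPL]; exact hL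
  exact h P hP1 hPd hPL hK₀M hk hkK h3h hmesh S Ω₂ hΩ₂ hsub Pf Y hδY hδPY hδP hs hρ hregY hregPY hregP htY htPY hcY hP
    (faces k K₀ S) (exists_face_of_mem_exB S Pf) (exists_face_of_mem_enB S Pf)
    (farI_of_supp hkK hRfar hsupp) (farC_of_supp hL2 hk hRfar hsupp) (nearP_of_supp hRnear hsupp) r₀ i₀


/-- **The `α = 0` member on a cell-product box with the far geometry from the support condition** — `B3Ineq25Op116CollarRegion.ineq25At_one_zero_collarBox`
with `hfarI` discharged by `B3Op116CollarConfig.farI_of_supp` (`ρL^k + L^k ≤ R`; no regularity of `P` alone and no near condition are needed at `α = 0`).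
[cite: Balaban1983Higgs3, (2.5) p.424, (1.16) p.414, p.433] [cite: Balaban1982Higgs1, Prop. 2.1 p.610, (1.3) p.604] -/
theorem ineq25At_one_zero_collarBox_of_supp (d L : ℕ) (hd : 1 ≤ d) (hL : 2 ≤ L) {a : ℝ} (ha : 0 < a) {msq : ℝ} (hmsq : 0 < msq)
    {c : ℝ} (hc : 0 ≤ c) (N m : ℕ) {c₁ c₂ : ℝ} (hc₁ : 0 ≤ c₁) (hc₂ : 0 ≤ c₂) :
    ∃ E₀ : ℝ, 0 < E₀ ∧ ∀ (C : ChargeData N), C.e ^ 2 ≤ E₀ →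
      ∃ K₀min : ℕ, ∀ K₀ : ℕ, K₀min ≤ K₀ → ∃ t δ δ₀ CG : ℝ, 0 < t ∧ 0 < δ ∧ δ ≤ 1 ∧ 0 < δ₀ ∧ 0 ≤ CG ∧
      ∀ (P : HiggsLattice.Params) (hP1 : 1 < P.L), P.d = d → P.L = L → K₀ ∣ P.M →
      ∀ {k : ℕ}, 1 ≤ k → k ≤ P.K → (∀ μ, 3 * half P k K₀ ≤ P.sitesPerDir 0 μ) → P.mesh k ≤ 1 →
      ∀ (S : Fin P.d → Finset ℕ) (Ω₂ : Finset (HiggsLattice.Site P 0)), IsBigBlockUnion k K₀ Ω₂ → Ω₂ ⊆ cellBox k K₀ S →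
      ∀ (Pf Y : HiggsLattice.VecField P 0) {δY δPY s ρ : ℝ}, 0 ≤ δY → 0 ≤ δPY → 0 ≤ s → 1 ≤ ρ →
        (∀ z ∈ cellBox k K₀ S, ∀ μ ν : Fin P.d, |Y ⟨z.shift ν, μ⟩ - Y ⟨z, μ⟩| ≤ δY) →
        (∀ z ∈ cellBox k K₀ S, ∀ μ ν : Fin P.d, |(Pf + Y) ⟨z.shift ν, μ⟩ - (Pf + Y) ⟨z, μ⟩| ≤ δPY) →
        (P.L : ℝ) ^ k * δY * |C.e| ≤ t → (P.L : ℝ) ^ k * δPY * |C.e| ≤ t → (P.L : ℝ) ^ k * δY ≤ c * |C.e| →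
        (∀ b : HiggsLattice.PBond P 0, |Pf b| ≤ s) →
      ∀ {R : ℝ}, ρ * (P.L : ℝ) ^ k + (P.L : ℝ) ^ k ≤ R →
        (∀ b : HiggsLattice.PBond P 0, Pf b ≠ 0 → ∀ x : HiggsLattice.Site P 0, Interior k K₀ Ω₂ x →
          R ≤ (HiggsLattice.Site.tdist x b.src : ℝ)) →
      ∀ r₀ : ℕ, Ix N →
        ∃ K : ℝ, 0 ≤ K ∧
          (sect2Smooth116 hP1 C (cellBox k K₀ S) Ω₂ Pf Y msq a k K₀ r₀ m c₁ c₂ (P.mesh k) 1).Ineq25At 1 0 0 (min δ₀ (δ / 4))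
            (CG + (P.mesh 0 ^ P.d)⁻¹ * farF P δ ρ * K) ∧
          (sect2Smooth116 hP1 C (cellBox k K₀ S) Ω₂ Pf Y msq a k K₀ r₀ m c₁ c₂ (P.mesh k) 1).Ineq25At 0 1 0 (min δ₀ (δ / 4))
            (CG + (P.mesh 0 ^ P.d)⁻¹ * farF P δ ρ * K) := by
  obtain ⟨E₀, hE₀, hG⟩ := B3Ineq25Op116CollarRegion.ineq25At_one_zero_collarBox d L hd hL ha hmsq hc N m hc₁ hc₂
  refine ⟨E₀, hE₀, fun C heC => ?_⟩
  obtain ⟨K₀min, h⟩ := hG C heC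
  refine ⟨K₀min, fun K₀ hK₀ => ?_⟩
  obtain ⟨t, δ, δ₀, CG, ht, hδ, hδ1, hδ₀, hCG, h⟩ := h K₀ hK₀
  refine ⟨t, δ, δ₀, CG, ht, hδ, hδ1, hδ₀, hCG, ?_⟩
  intro P hP1 hPd hPL hK₀M k hk hkK h3h hmesh S Ω₂ hΩ₂ hsub Pf Y δY δPY s ρ hδY hδPY hs hρ hregY hregPY htY htPY hcY hP R hRfar hsupp r₀ i₀
  exact h P hP1 hPd hPL hK₀M hk hkK h3h hmesh S Ω₂ hΩ₂ hsub Pf Y hδY hδPY hs hρ hregY hregPY htY htPY hcY hP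
    (farI_of_supp hkK hRfar hsupp) r₀ i₀

end ClassC


end Literature.MathematicalPhysics.QuantumFieldTheory.Balaban1983to89.B3Ineq25Op116CollarRegionHolder

end
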